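import Literature.MathematicalPhysics.QuantumFieldTheory.Balaban1983to89.T4CombSecondDifference

/-!
# `Balaban1983to89.T4CombSecondRaw` — THE SECOND-ORDER LETTER `γγE` DISCHARGED FROM RAW BLOCK SUPS: second lattice
# differences of the relative comb gauge and of the gauge-fixed deviation field, and the window of
# `T4CombSecondDifference` §8 fed by raw block sups only (cell row T4-O3.E-NE1′-OG1′-RESID-S1*, node O3, estimate
# NE1′, located obligation O-G1′; residual (S1) of GAPS G-pv24g12-1)

PRINTED (all COPY — quotations certified in the header of `T4CombHolderWindow` (GAPS C-pv24g11-1, cross-read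
C-adv4-86) and of `T4BirthChartTransport` (C-pv20-33); NOT re-read by this seat (nor by the seat of `T4CombSecondDifference`); B8 = [Balaban1985RegularSpaces],
B9 = [Balaban1985BackgroundPropagators], B12 = [Balaban1987RG1]):
* B9 p. 396: "|A| < O(1)Mα₀(L^jη)^{−1}, |∇^ηA| < O(1)Mα₀(L^jη)^{−2} on □, where O(1)M is a size of □ in T_{L−j};
  (3.35) |∂^{η*}∂^ηA| < O(1)Mα₀(L^jη)^{−3} on □. (3.36)"; "U satisfies the condition (3.35), and |A′| <
  α₁(L^jη)^{−1}, |∇^η_UA′| < α₁(L^jη)^{−2} on Ω_j, j = 0, …, k; (3.37) U satisfies (3.35), (3.36), A′ satisfies (3.37)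
  and |D^{η*}_UD^η_UA′| < α₁(L^jη)^{−3} on Ω_j, j = 0, …, k. (3.38)"
  [cite: Balaban1985BackgroundPropagators, (3.35)–(3.38) p. 396]
* B8 p. 82: "… U₁ = U′u^{−1} satisfies the conditions U₁ = e^{iηA}, |A| < B₁(α₀ + α₁)(L^jη)^{−1}, |∇^η_{U₀}A| <
  B₁(α₀ + α₁)(L^jη)^{−2}, ‖A‖_{1,β} < B₂(β₀)(α₀ + α₁)(L^jη)^{−2−β}, β ≦ β₀ < 1, on Ω_j, j = 0, 1, …, k, (1.36)"
  [cite: Balaban1985RegularSpaces, (1.36) p. 82]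
* B9 p. 397: "the Hölder norms ‖A‖_α = max_μ sup_{x,x′:|x−x′|≤1} (1/|x′ − x|^α)|R(U(Γ_{x,x′}))A_μ(x′) − A_μ(x)|, (3.40)
  ‖A‖_{1,α} = ‖∇A‖_α = max_{μ,ν} sup_{x,x′:|x−x′|≤1} (1/|x′ − x|^α)|R(U(Γ_{x,x′}))(D_μA_ν)(x′) − (D_μA_ν)(x)|"
  [cite: Balaban1985BackgroundPropagators, (3.40) p. 397]
* B12 p. 276: "(3.31) |𝐀|, |∇^η𝐀|, ‖𝐀‖_{1,β} < α₂ on □₀"  [cite: Balaban1987RG1, (3.31) p. 276]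

PRINTED — READ AS IMAGES by the v1.1 / v1.2 seat (2026-08-19; renders `b2b-balaban-ref1/pages/<stem>/<stem>-pNNN-x2.png`;
GAPS C-pv24g14-1 and its ADDENDUM; cell record `t4/T4-EST-OG1p-D3.md` §1 has the full displays):
* B8 p. 78 (v1.2): "There are many gauge conditions. An axial gauge is defined by the equations for x_j ∈ Λ_j, j = 1,
  …, k, we put Ū^{j−1}(Γ_{x_j,x_{j−1}}) = 1 for x_{j−1} ∈ B(x_j), Ū^{j−2}(Γ_{x_{j−1},x_{j−2}}) = 1 for x_{j−2} ∈ B(x_{j−1}), …,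
  Ū(Γ_{x₂,x₁}) = 1 for x₁ ∈ B(x₂), U(Γ_{x₁,x}) = 1 for x ∈ B(x₁). (1.15)" — the printed axial gauge is HIERARCHICAL:
  one tree (comb) per block `B(·)` of side `L` on EACH scale, applied to the averaged configurations `Ū^{i}`; the
  tree's single comb over `B(z)` of side `L` has the shape of its lowest level.  [cite: Balaban1985RegularSpaces, (1.15) p. 78]
* B8 p. 77: "|U(∂p) − 1| < α₀L^{−2j} for p ∈ Ω_j, j = 0, 1, …, k, (1.7)"; "|(D^{η*}_U ∂U)(b)| < α₀L^{−2j}(L^jη)^{−1}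
  for b ∈ Ω_j, j = 0, 1, …, k. (1.9)"; "These conditions are invariant with respect to gauge transformations."
  [cite: Balaban1985RegularSpaces, (1.7)/(1.9) p. 77]
* B8 p. 83: "Thus (1.36) contains all the results we have to prove about A, besides its existence. This condition
  describes fully regularity properties of the first order derivatives. Such information is unavailable for the
  second order derivatives, but we have the following bounds for the second order operators acting on A:
  |D^{η*}_{U₀}D^η_{U₀}A|, |Δ^η_{U₀}A| < B₁(α₀+α₁)(L^jη)^{−3} on Ω_j, j = 0, 1, …, k. (1.39)"; "U₀, U₁U₀ ∈
  𝔘_k({Ω_j}, α₀), U₀ satisfies the additional regularity condition (3.35) in [4], (1.40)"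
  [cite: Balaban1985RegularSpaces, (1.39)/(1.40) p. 83]
* B9 p. 396: "For the operators introduced until now we need only the condition (3.35), but later on we will have to
  assume (3.36) also."; B9 p. 397: "|A| = max_μ sup_x |A_μ(x)|, |∇A| = max_{μ,ν} sup_x |(D_μA_ν)(x)|, (3.39)";
  Theorem 3.1: "a constant B₀(β) dependent on d, L and β, 0 ≦ β < 1 (B₀(β) → ∞ if β → 1)"
  [cite: Balaban1985BackgroundPropagators, p. 396; (3.39) and Thm 3.1 p. 397]
* B12 p. 272: "In the next steps we will construct an expansion of 𝐇_j, and for terms in this expansion we will have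
  good bounds, including bounds for the covariant Laplace operator. Such bounds do not hold for the operator D*D, and
  this is the reason why we do not formulate second order regularity conditions, as in (1.9) [14], (2) [15], but we
  replace the expression J_j by the new variable 𝐉."  [cite: Balaban1987RG1, p. 272]
* B12 p. 277: "The assumption (3.31) implies that A satisfies |A|, |∇^ηA|, ‖A‖_{1,β} < 2(α₂ + B₃O(1)Mα₀) on □̃⁴.
  (3.32) These regularity conditions are basic for the further analysis."  [cite: Balaban1987RG1, (3.32) p. 277]

HONEST FRAMING (cell `pub-balaban`, T4-DAG PAGE 1).  The cell's T4 target is the existence AND uniqueness of the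
continuum limit of Bałaban's unit-scale averaged loop expectations on a FINITE four-torus, at rung (B)+1 of the cell's
ladder — CONDITIONAL on the perturbative β-function hypothesis BetaPertH and on the running-coupling hypotheses
(B)/(B^μ) wherever a consumer uses them (none is used IN this file); it is NOT an infinite-volume statement, NOT the
Yang–Mills mass gap and NOT the Clay problem.  NO statement about Bałaban's renormalization-group objects is asserted:
every curvature / gradient / second-gradient datum below is a HYPOTHESIS SHAPE (a block sup binder).

THE QUESTION LEFT (GAPS G-pv24g12-1, residual (S1), verbatim): "(S1) the SECOND-ORDER RAW DISCHARGE of the letter γγE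
(the second differences of the gauge-fixed deviation field E = plaq(U₁^g) − plaq U₀ from raw U₀/U₁ data: the
second-order analogue of `T4RelativeCombGradient.deviation_gradient_le`, i.e. second differences of the comb gauge g
through the re-combing identity `combGauge_step` twice — pure volume, the cheapest next kernel row of the lineage)".
Upstream state: `T4CombSecondDifference.windowData_comb_second_raw` (v1.1, §8) takes every FIRST-order letter from
raw block sups but keeps the three SECOND-order letters `γγU` (base bonds), `γγP` (base plaquettes), `γγE` (the
gauge-fixed deviation field) as hypotheses; of these only `γγE` is COMPOSITE (it involves the comb gauge `g`).

WHAT THIS FILE DOES (bookkeeping on the existing seam; every analytic input stays a hypothesis).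
§0 [folklore] SECOND-ORDER ALGEBRA in a normed ring: the mixed second difference of a TWO-SIDED STEP MAP `X ↦ A·X·B`
   over a 2×2 grid (`norm_stepMap_dd_le`: `(A′X′B′ − X′) − (AXB − X) = (A′ − A)X′B′ + (A − 1)[(X′ − X)B′ + X(B′ − B)]
   + (X′ − X)(B′ − 1) + X(B′ − B)`, every term second order), the near-identity estimates for `u⁻¹w⁻¹`
   (`norm_invinv_sub_one_le`, `norm_invinv_sub_invinv_le`), deviation grids (`GridBnd.of_sub_const`), and THE MIXED
   SECOND DIFFERENCE OF A CONJUGATED DEVIATION `E = gPg⁻¹ − B` (`norm_conjDev_dd_le`: `≤ γγ + 4δ_g·γ + 2q·δδ_g +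
   4q·δ_g² + γγ′` from the gauge grid `(1, δ_g, δδ_g)`, the grid `(q, γ, γγ)` of `P − 1` and `‖Δ²B‖ ≤ γγ′` — the
   product and inverse rules of `T4CombSecondDifference.GridBnd` on `g(P − 1)g⁻¹`; the gauge variation always meets a
   factor `P − 1` or a difference of `P`).
§1 [folklore] THE SECOND LATTICE DIFFERENCES OF THE RELATIVE COMB GAUGE: by the re-combing identity
   `g(x+e_μ) = U₀⟨x,μ⟩⁻¹·W⟨x,μ⟩⁻¹·g(x)·U₁⟨x,μ⟩` (`T4RelativeCombGradient.combGauge_step`) at `x` and at `x+e_ρ`,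
   `Δ_μΔ_ρ g` is the second difference of a two-sided step map: `norm_combGauge_dd_le` (local form) and
   `norm_combGauge_dd_le_of_sup` (block-sup form: `‖Δ_μΔ_ρ g‖ ≤ gaugeHess C s τ₀ τ₁ G γU γU₁ = (γU + G) +
   (τ₀ + C·s)(δ_g + γU₁) + δ_g·τ₁ + γU₁`, `δ_g = gaugeStep C s τ₀ τ₁ = τ₀ + C·s + τ₁` the one-bond variation
   (`norm_combGauge_sub_le`, `T4RelativeCombGradient.norm_combGauge_step_sub_le` + the master count
   `T4CombSecondDifference.norm_defect_sub_one_le`), `C = (d−1)(L−1)`; `G` = the defect gradient, `γU, γU₁` = plain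
   bond gradients of `U₀, U₁`).
§2 THE DISCHARGE `deviation_second_le`: in EXACTLY the binder shape of the hypothesis `hγγE` of
   `T4CombSecondDifference.norm_second_diff_le` / `windowData_comb_second(_raw)`, `‖Δ_μΔ_ρ E‖ ≤ γγE_raw :=
   devHessPoly C s q₁ τ₀ τ₁ G γU γU₁ γ₁ γγP γγ₁ = γγ₁ + 4δ_g·γ₁ + 2q₁·δδ_g + 4q₁·δ_g² + γγP` from block sups of RAW
   data (gauge covariance `T4RelativeComb.plaq_gaugeAct`: `E = g(P₁ − 1)g⁻¹ − (P₀ − 1)`; §0 on the comb-gauge grid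
   of §1 and the grid `(q₁, γ₁, γγ₁)` of `P₁ − 1`).
§3 THE WINDOW RE-PLUMBED: `windowData_comb_second_allRaw` / `block_transport_comb_window_second_allRaw` =
   `T4CombSecondDifference.windowData_comb_second_raw` / `T4CombHolderWindow.block_transport_window` BY NAME with
   `γγE := γγE_raw` (and `G := G_raw` inside it, `T4RelativeCombGradient.norm_gradient_le_raw`): the hypotheses are
   now the TWELVE raw block sups `s, q₀, q₁, τ₀, τ₁, γU, γU₁, γ₀, γ₁, γγU, γγP, γγ₁` — sups of norms of PLAIN lattice
   differences of orders 0, 1, 2 of the two configurations' bond and plaquette variables, plus the gauge-fixed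
   deviation sup `s` of Lemma 1's format — and NO composite letter.
§4 [arith] THE RATE (cell reading): under the plaquette-level dictionary `D₃` (`D₂` of `T4CombSecondDifference` §8
   plus `γU₁ ≤ cθ²`, `γγ₁ ≤ cθ⁴`, and the base-plaquette second difference at its natural rate `γγP ≤ cθ⁴`):
   `δ_g ≤ 3c²θ` (`gaugeStep_le_rate`), `δδ_g ≤ 34c⁴θ²` (`gaugeHess_le_rate`), `γγE_raw ≤ 118c⁵θ⁴`
   (`devHessPoly_le_rate`), so the dictionary `D₂` of `T4CombSecondDifference.secondDev_raw_le_rate` holds with the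
   constant `c″ = 118c⁵`: `σ ≤ 73(21c″⁴)⁴θ³` (`secondDev_allRaw_le_rate`) and the all-raw window sits inside the
   `θ`-INDEPENDENT multiple `a(21c″⁴, β)` of the printed window `κ(θ) = (θ, θ², θ^{2+β})`
   (`winN_printWin_second_allRaw_le`) — the composition from raw block sups typed as ONE theorem.
§5 non-vacuity (the flat pair over `ℝ` inhabits every hypothesis of `deviation_second_le` with all constants `0`, and
   the bound is `0`).
§6 [arith] (v1.1) THE DICTIONARY UNDER PRINTED-TYPE INPUTS (located audit `t4/T4-EST-OG1p-D3.md`, GAPS G-pv24g14-1).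
   Of `D₃`'s letters only `s, q₀, q₁, τ₀, τ₁, γU, γU₁` and the count `Cθ ≤ c` have printed sup counterparts at their
   rate ((1.7) with (1.33)/(1.34)/(1.40); (1.26); (3.35) with (3.39); (1.36)/(1.41)/(3.37); the count of B8 p. 79);
   `γ₀, γ₁, γγU ≤ cθ³` and `γγP, γγ₁ ≤ cθ⁴` are the DIMENSIONAL reading with NO printed sup counterpart — print
   bounds second ORDER only through covariant Laplacians ((1.9), (1.39), (3.36), (3.38)) and mixed second
   differences only through Hölder-`β` seminorms of first derivatives, `β ≦ β₀ < 1` ((1.36), (3.31)/(3.32), (3.40)),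
   and says so: "Such information is unavailable for the second order derivatives" (B8 p. 83), "Such bounds do not
   hold for the operator D*D" (B12 p. 272), "B₀(β) → ∞ if β → 1" (B9 p. 397).  With the printed-type
   (Hölder-derived) rate `θ^{2+β}` for the second-order letters the σ-slot is `θ^{2+β}` and the interpolated Hölder
   entry is `θ^{2+β²}` (`interp_exponent_holderInputs`, `interp_hol_entry_holderInputs`), which for `0 < β < 1` is
   NOT within a `θ`-independent multiple of the slot `θ^{2+β}` (`not_uniform_holderInputs`); `le_devHessPoly`
   records that `γγ₁, γγP` enter `γγE_raw` with coefficient one.  So `winN_printWin_second_allRaw_le` is uniform in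
   `θ` under `D₃`; what the PRINTED-TYPE inputs give instead depends on the size of the comb count `C` and is
   settled in §7 (v1.2), which CORRECTS the v1.1 gloss printed here («ONLY under second-order inputs of `D₃`'s
   strength; the honest successor is a window fed by m-step Hölder letters»): that gloss holds for the
   INTERPOLATION ROUTE, not for the window.
§7 [folklore]+[arith] (v1.2) THE TELESCOPED HÖLDER ENTRY AND THE TWO READINGS OF THE COMB COUNT (GAPS G-pv24g14-1
   ADDENDUM; record `t4/T4-EST-OG1p-D3.md` v1.1).  `windowData_telescope`: window data with a Lipschitz-in-steps
   third slot (exponent `1`, entry `h`) is `β`-window data with entry `L^{1−β}·h`, because interior axis pairs of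
   one block are `m < L` steps apart (`lt_of_inBlock_nsmul`) — NO interpolation against the gradient slot;
   `windowData_comb_second_allRaw_tel`: the all-raw window of §3 with third slot `L^{1−β}·σ`, BY NAME from §3 at
   exponent `1`.  READING (A) — the block side `L` is the FIXED integer of the construction, as at every level of
   the printed axial gauge (1.15) (B8 p. 78: one tree per block `B(·)` of side `L` on each scale), so the count
   `C = (d−1)(L−1) ≤ c` is a CONSTANT while `θ = L^{−j}` is the independent small parameter: under the
   PRINTED-TYPE dictionary (first-order letters as in `D₃`; ALL second-order letters at the Hölder-derived rate,
   `γ₀, γ₁, γγU, γγP, γγ₁ ≤ cθ^{2+β}`) `G_raw ≤ 21c⁴θ²` (`gradPoly_le_rateA`), `γE_raw ≤ 8c⁵θ^{2+β}`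
   (`devGradPoly_le_rateA`), `γγE_raw ≤ 118c⁵θ^{2+β}` (`devHessPoly_le_rateA`), `σ ≤ 73(118c⁵)⁵θ^{2+β}`
   (`secondDev_le_rateA`, `secondDev_allRaw_le_rateA`), and the telescoped window sits inside the `θ`-INDEPENDENT
   multiple `22c⁴ + L^{1−β}·73(118c⁵)⁵` of `printWin θ β` (`winN_printWin_second_allRaw_tel_le`) — NO letter
   beyond printed type and NO interpolation (whose exponent under the same inputs is only `2 + β²`, §6).  READING
   (B) — ONE comb over a block of side `L^j` (`C = (d−1)(L^j−1)`, only `Cθ ≤ c`, the coupling written into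
   `D₂`/`D₃`): the count multiplies the plaquette letters (`le_gradPoly_C`: `C·(γ₀ + γ₁) ≤ G_raw`;
   `secondW = secondFoot + C·secondSrc` upstream), so printed-type plaquette gradients give the gradient-entry term
   `C·γ₀ = c²θ^{1+β}` (`readingB_gradTerm`), NOT within a `θ`-independent multiple of the gradient weight `θ²`
   (`gradSlot_not_uniform_readingB`, from the general `rpow_not_dominated`): the window fails ALREADY AT THE
   GRADIENT SLOT, and `D₃`'s non-printed rates `θ³`/`θ⁴` are precisely what reading (B) would need.  Which reading
   a consumer of the window adopts is NOT decided in this file (cell decision; both are typed).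

HONEST SCOPE / NOT CLAIMED.  (a) PLAIN lattice differences of `R`-valued bond variables (no covariant `∇_U`, no
parallel transport in quotients — print (3.36)/(3.38)/(3.40) has both); (b) second differences are the MIXED
axis-parallel ones `Δ_μΔ_ρ` over one block `B(z)` (incl. `μ = ρ`), unitary-like pairs only, no patching across
blocks, no complex gauge group; (c) the remaining inputs `γγU, γγP, γγ₁` (plain second differences of the base bonds,
the base plaquettes, the `U₁` plaquettes) and all first/zeroth-order letters are HYPOTHESES (block sup binders) on
the two configurations — nothing is asserted about Bałaban's fields, and `s` (the gauge-fixed deviation sup in the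
comb gauge, Lemma 1's format) is not re-derived from anything; (d) the rate table `D₃` of §4 is a CELL READING of
the printed scales (as `T4CombHolderWindow.printWin`, `T4CombSecondDifference` §6/§8), not print — by the located
audit of v1.1 (§6) five of its letters (`γ₀, γ₁, γγU, γγP, γγ₁`) have NO printed sup counterpart at the stated rate —
under reading (A) of §7 they are not NEEDED beyond their printed-type rate `θ^{2+β}` (with `C ≤ c`), under reading (B)
they are needed and unavailable — and no regime claim is made about Bałaban's configurations; which reading applies to
a given consumer is not decided here; (e) constants are explicit polynomials, not optimised (`118c⁵`,
`73(21(118c⁵)⁴)⁴`, `73(118c⁵)⁵`, `22c⁴`); (f) NOT summit progress: rung (B)+1 bookkeeping on a FINITE torus ≠ infinite volume / mass gap /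
Clay.  The residuals (S2) (covariant/Hölder-quotient format of (3.40)) and (S3) (patching across blocks) of GAPS
G-pv24g12-1 are untouched.

NOVELTY / NEAREST PRINT (records, NOT sources).  Inside the series: (3.36)/(3.38)/(1.39) are the printed
second-ORDER format — covariant / plain LAPLACIANS at `(L^jη)^{−3}`; mixed second derivatives are printed only as
Hölder-`β` seminorms of first derivatives ((1.36), (3.32), (3.40), `β ≦ β₀ < 1`; B8 p. 83: "Such information is
unavailable for the second order derivatives").  ERRATUM (v1.1, GAPS G-pv24g14-1): v1 of this sentence ("(3.36)/(3.38)
are the printed second-gradient format"), `T4CombSecondDifference` l.81–82 / l.109–110 / l.1439 / l.1526 and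
`T4CombHolderWindow` l.90 / l.805–807 over-read (3.35)–(3.38)/(1.36) as asserting the rates `θ³`/`θ⁴` of the mixed
second-difference letters; they do not (those two files are corrected at their next substantive revisions; no kernel
statement is affected — all are hypothesis-shaped).  ERRATUM (v1.2, GAPS G-pv24g14-1 ADDENDUM, CLAIMS CORRECTION l.53868):
v1.1's §6 gloss («uniform in θ under D₃ and ONLY under second-order inputs of D₃'s strength; the honest successor is a
window fed by m-step Hölder letters») silently took the comb count `θ^{−1}`-large in the Hölder slot and `O(1)` in the
gradient slot; §7 types both readings: constant count ⟹ the printed-type inputs CLOSE the window by telescoping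
(no interpolation, no extra letter); `Cθ ≍ c` ⟹ the gradient slot fails first.  No v1/v1.1 statement is affected.  The
relative comb construction for TWO configurations and its difference calculus are cell-side (GAPS
C-pv04g14-2, C-pv24g10-1, C-pv24g11-1, C-pv24g12-1: no printed counterpart located).  Outside the series: the
precedents recorded in `T4CombHolderWindow` / `T4CombSecondDifference` (Chevyrev, CMP 372 (2019) §4; Federbush III,
CMP 110 (1987); Chatterjee 2016, Lemma 10.2, per the t4-lit NOTE of 2026-08-19 and the cell record `t4/T4-LITERATURE.md` — one-configuration
axial/tree-gauge bounds, named as precedents for SHAPES only; nothing of them is used).  Presearch of this seat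
(2026-08-19, corpus fts+vec and galaxy): generic axial-gauge textbook material only (Creutz 2022 pp. 44, 81;
Montvay–Münster 1994 p. 390; Greensite 2011 pp. 21–22); no second-difference bookkeeping of a relative tree gauge of
two configurations located.

LABELS.  [printed] = quoted above (the COPY block and the block READ AS IMAGES by the v1.1 seat); [folklore] = elementary normed-ring algebra / lattice bookkeeping on
abstract data; [cell reading] = the scale dictionary of §4; (arith) = real arithmetic.  IMPORTS BY NAME ONLY
(one-writer files of other lineages are never edited): `T4CombSecondDifference` (pv24, this lineage: `GridBnd` with
`mul`/`inv`, `secondDev`, `norm_defect_sub_one_le`, `devGradRaw`, `windowData_comb_second_raw`, `gradPoly`,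
`devGradPoly`, `gradPoly_le_rate`, `secondDev_raw_le_rate`, `winN_printWin_second_raw_le`, `secondDev_nonneg`, `gradPoly_nonneg`), `T4CombHolderWindow`
(pv24: `WindowData`, `blockDev`, `block_transport_window`, `winN`, `printWin`, `gradRaw`, `fdiff`, `add_nsmul_e_apply`,
`winN_printWin_le_iff`), `T4RelativeCombGradient`
(pv24: `combGauge_step`, `norm_combGauge_step_sub_le`, `norm_gradient_le_raw`, `unitaryLike_defect`,
`combGauge_self`), `T4RelativeComb` (pv04: `Cfg`, `plaq`, `gaugeAct`, `plaq_gaugeAct`, `combGauge`,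
`unitaryLike_combGauge`, `defect`, `PlaqSup`), `T4RelativeLadder` (pv04: `UnitaryLike`, `norm_mul_unit_le`,
`norm_unit_mul_le`, `norm_inv_sub_one_le`, `norm_inv_sub_inv_le`), `T4BlockTransport` (t4-ne1p-p1: `Fld`, `val`,
`BlockRel`), `T4BirthChartTransport` (pv20: `GaugeInvariant`, `BirthSlice`), `B8Lemma1Lattice` (`e`, `InBlock`).

REVISIONS.  v1 p188136 (2026-08-19, §0–§5).  v1.1 (2026-08-19, same one-writer lineage pv24): §6 added (four (arith)
theorems; append-only — no v1 statement or proof changed); header PRINTED block extended by quotations READ AS IMAGES;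
the NOVELTY sentence on (3.36)/(3.38) corrected (ERRATUM above); HONEST SCOPE (d) sharpened; DOCFIX D1 of the v1
cross-read (GAPS C-pv05g13-7: `devHessPoly` docstring "+ γγ₀" → "+ γγP") folded.  v1.2 (2026-08-19, pv24): §7 added
(`lt_of_inBlock_nsmul`, `windowData_telescope`, `rpow_one_sub_le_self`, `windowData_comb_second_allRaw_tel`; the
reading-(A) rate theorems `gradPoly_le_rateA`, `devGradPoly_le_rateA`, `devHessPoly_le_rateA`, `secondDev_le_rateA`,
`secondDev_allRaw_le_rateA`, `winN_printWin_second_allRaw_tel_le` with their (arith) helpers; the reading-(B) records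
`le_gradPoly_C`, `readingB_gradTerm`, `rpow_not_dominated`, `gradSlot_not_uniform_readingB`; append-only — no v1/v1.1
statement or proof changed); the §6 prose of this header, the §6 section docstring and the `not_uniform_holderInputs`
docstring CORRECTED to the reading split (ERRATUM v1.2 above); PRINTED block READ AS IMAGES extended by (1.15) p. 78.
-/

namespace Literature.MathematicalPhysics.QuantumFieldTheory.Balaban1983to89.T4CombSecondRaw

open B8Lemma1Lattice (e InBlock)
open T4RelativeLadder (UnitaryLike norm_mul_unit_le norm_unit_mul_le norm_inv_sub_one_le norm_inv_sub_inv_le)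
open T4RelativeComb (Cfg gaugeAct plaq plaq_gaugeAct combGauge unitaryLike_combGauge defect PlaqSup)
open T4RelativeCombGradient (unitaryLike_defect combGauge_step norm_combGauge_step_sub_le combGauge_self)
open T4CombHolderWindow (Win winN WindowData blockDev wMove wN block_transport_window printWin gradRaw gradRaw_nonneg)
open T4CombSecondDifference (GridBnd secondDev norm_defect_sub_one_le devGradRaw windowData_comb_second_raw
  gradPoly devGradPoly gradPoly_le_rate gradPoly_nonneg secondDev_raw_le_rate winN_printWin_second_raw_le)
open T4BlockTransport (Fld val BlockRel)
open T4BirthChartTransport (GaugeInvariant BirthSlice)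

variable {R : Type*} [NormedRing R] {d : ℕ}

/-- [folklore] Sites of the `d`-dimensional lattice (= `B8Lemma1Lattice.Site`). -/
abbrev Site (d : ℕ) : Type := Fin d → ℤ

/-! ## §0  [folklore] Second-order algebra: the two-sided step map and the conjugated deviation on a 2×2 grid -/

section Algebra

/-- [folklore] THE MIXED SECOND DIFFERENCE OF A TWO-SIDED STEP MAP.  For `X ↦ A·X·B` evaluated on a 2×2 grid —
`X, B` and the primed `X′, B′` unitary-like units, `A, A′` ring elements — the identity
`(A′X′B′ − X′) − (AXB − X) = (A′ − A)X′B′ + (A − 1)[(X′ − X)B′ + X(B′ − B)] + (X′ − X)(B′ − 1) + X(B′ − B)`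
gives `‖(A′X′B′ − X′) − (AXB − X)‖ ≤ a′ + a(ξ + b′) + ξ·b + b′` from `‖A − 1‖ ≤ a`, `‖A′ − A‖ ≤ a′`, `‖X′ − X‖ ≤ ξ`,
`‖B′ − 1‖ ≤ b`, `‖B′ − B‖ ≤ b′`: every term is a product of two first-order quantities or a first difference of the
data `A, B` — SECOND ORDER. -/
theorem norm_stepMap_dd_le {A A' : R} {X X' B B' : Rˣ} (hX : UnitaryLike X) (hX' : UnitaryLike X')
    (hB' : UnitaryLike B') {a a' ξ b b' : ℝ} (ha : ‖A - 1‖ ≤ a) (ha' : ‖A' - A‖ ≤ a')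
    (hξ : ‖(X' : R) - X‖ ≤ ξ) (hb : ‖(B' : R) - 1‖ ≤ b) (hb' : ‖(B' : R) - B‖ ≤ b') :
    ‖(A' * X' * B' - X') - (A * X * B - X)‖ ≤ a' + a * (ξ + b') + ξ * b + b' := by
  have ha0 : 0 ≤ a := (norm_nonneg _).trans ha
  have hξ0 : 0 ≤ ξ := (norm_nonneg _).trans hξ
  have e : (A' * X' * B' - X') - (A * X * B - X) =
      (A' - A) * X' * B' + (A - 1) * (((X' : R) - X) * B' + X * ((B' : R) - B)) +
        ((X' : R) - X) * ((B' : R) - 1) + (X : R) * ((B' : R) - B) := by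
    noncomm_ring
  rw [e]
  have t1 : ‖(A' - A) * X' * B'‖ ≤ a' :=
    ((norm_mul_unit_le hB' _).trans (norm_mul_unit_le hX' _)).trans ha'
  have t2 : ‖(A - 1) * (((X' : R) - X) * B' + X * ((B' : R) - B))‖ ≤ a * (ξ + b') := by
    refine (norm_mul_le _ _).trans (mul_le_mul ha ?_ (norm_nonneg _) ha0)
    exact (norm_add_le _ _).trans (add_le_add ((norm_mul_unit_le hB' _).trans hξ)
      ((norm_unit_mul_le hX _).trans hb'))
  have t3 : ‖((X' : R) - X) * ((B' : R) - 1)‖ ≤ ξ * b :=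
    (norm_mul_le _ _).trans (mul_le_mul hξ hb (norm_nonneg _) hξ0)
  have t4 : ‖(X : R) * ((B' : R) - B)‖ ≤ b' := (norm_unit_mul_le hX _).trans hb'
  calc _ ≤ ‖(A' - A) * X' * B' + (A - 1) * (((X' : R) - X) * B' + X * ((B' : R) - B)) +
          ((X' : R) - X) * ((B' : R) - 1)‖ + ‖(X : R) * ((B' : R) - B)‖ := norm_add_le _ _
    _ ≤ ‖(A' - A) * X' * B'‖ + ‖(A - 1) * (((X' : R) - X) * B' + X * ((B' : R) - B))‖ +
          ‖((X' : R) - X) * ((B' : R) - 1)‖ + ‖(X : R) * ((B' : R) - B)‖ := add_le_add norm_add₃_le le_rfl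
    _ ≤ _ := add_le_add (add_le_add (add_le_add t1 t2) t3) t4

/-- [folklore] `‖u⁻¹w⁻¹ − 1‖ ≤ ‖u − 1‖ + ‖w − 1‖` for unitary-like units (`u⁻¹w⁻¹ − 1 = (u⁻¹ − 1)w⁻¹ + (w⁻¹ − 1)`,
`T4RelativeLadder.norm_inv_sub_one_le`). -/
theorem norm_invinv_sub_one_le {u w : Rˣ} (hu : UnitaryLike u) (hw : UnitaryLike w) :
    ‖((u⁻¹ : Rˣ) : R) * ((w⁻¹ : Rˣ) : R) - 1‖ ≤ ‖(u : R) - 1‖ + ‖(w : R) - 1‖ := by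
  rw [show ((u⁻¹ : Rˣ) : R) * ((w⁻¹ : Rˣ) : R) - 1 =
    (((u⁻¹ : Rˣ) : R) - 1) * ((w⁻¹ : Rˣ) : R) + (((w⁻¹ : Rˣ) : R) - 1) by noncomm_ring]
  exact (norm_add_le _ _).trans (add_le_add ((norm_mul_unit_le hw.inv _).trans (norm_inv_sub_one_le hu))
    (norm_inv_sub_one_le hw))

/-- [folklore] `‖u′⁻¹w′⁻¹ − u⁻¹w⁻¹‖ ≤ ‖u′ − u‖ + ‖w′ − w‖` for unitary-like units
(`= (u′⁻¹ − u⁻¹)w′⁻¹ + u⁻¹(w′⁻¹ − w⁻¹)`, `T4RelativeLadder.norm_inv_sub_inv_le`). -/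
theorem norm_invinv_sub_invinv_le {u u' w w' : Rˣ} (hu : UnitaryLike u) (hu' : UnitaryLike u')
    (hw : UnitaryLike w) (hw' : UnitaryLike w') :
    ‖((u'⁻¹ : Rˣ) : R) * ((w'⁻¹ : Rˣ) : R) - ((u⁻¹ : Rˣ) : R) * ((w⁻¹ : Rˣ) : R)‖ ≤
      ‖(u' : R) - u‖ + ‖(w' : R) - w‖ := by
  rw [show ((u'⁻¹ : Rˣ) : R) * ((w'⁻¹ : Rˣ) : R) - ((u⁻¹ : Rˣ) : R) * ((w⁻¹ : Rˣ) : R) =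
    (((u'⁻¹ : Rˣ) : R) - ((u⁻¹ : Rˣ) : R)) * ((w'⁻¹ : Rˣ) : R) +
      ((u⁻¹ : Rˣ) : R) * (((w'⁻¹ : Rˣ) : R) - ((w⁻¹ : Rˣ) : R)) by noncomm_ring]
  exact (norm_add_le _ _).trans (add_le_add
    ((norm_mul_unit_le hw'.inv _).trans (norm_inv_sub_inv_le hu' hu))
    ((norm_unit_mul_le hu.inv _).trans (norm_inv_sub_inv_le hw' hw)))

/-- [folklore] A grid of DEVIATIONS `f − c` from a constant: values bounded separately, differences those of `f`. -/
theorem GridBnd.of_sub_const {f₀₀ f₁₀ f₀₁ f₁₁ c : R} {A δ δδ : ℝ} (n₀₀ : ‖f₀₀ - c‖ ≤ A) (n₁₀ : ‖f₁₀ - c‖ ≤ A)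
    (n₀₁ : ‖f₀₁ - c‖ ≤ A) (n₁₁ : ‖f₁₁ - c‖ ≤ A) (d₁₀ : ‖f₁₀ - f₀₀‖ ≤ δ) (d₁₁ : ‖f₁₁ - f₀₁‖ ≤ δ)
    (d₀₁ : ‖f₀₁ - f₀₀‖ ≤ δ) (d₁₁' : ‖f₁₁ - f₁₀‖ ≤ δ) (dd : ‖f₁₁ - f₁₀ - f₀₁ + f₀₀‖ ≤ δδ) :
    GridBnd (f₀₀ - c) (f₁₀ - c) (f₀₁ - c) (f₁₁ - c) A δ δδ where
  n₀₀ := n₀₀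
  n₁₀ := n₁₀
  n₀₁ := n₀₁
  n₁₁ := n₁₁
  d₁₀ := by rwa [sub_sub_sub_cancel_right]
  d₁₁ := by rwa [sub_sub_sub_cancel_right]
  d₀₁ := by rwa [sub_sub_sub_cancel_right]
  d₁₁' := by rwa [sub_sub_sub_cancel_right]
  dd := by rwa [show f₁₁ - c - (f₁₀ - c) - (f₀₁ - c) + (f₀₀ - c) = f₁₁ - f₁₀ - f₀₁ + f₀₀ by abel]

/-- [folklore] **THE MIXED SECOND DIFFERENCE OF A CONJUGATED DEVIATION** `E = g·P·g⁻¹ − B` over a 2×2 grid: with the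
gauge grid `(1, δg, δδg)` (unitary-like), the grid `(q, γ, γγ)` of `P − 1`, and `‖Δ²B‖ ≤ γγ′`:
`‖Δ²E‖ ≤ γγ + 4δg·γ + 2q·δδg + 4q·δg² + γγ′` — `g P g⁻¹ − B = g(P − 1)g⁻¹ − (B − 1)`, the product and inverse
rules of `T4CombSecondDifference.GridBnd` on `g·(P − 1)·g⁻¹` (the gauge variation always meets a factor `P − 1`
or a difference of `P`: SECOND ORDER). -/
theorem norm_conjDev_dd_le {g₀₀ g₁₀ g₀₁ g₁₁ : Rˣ} (h₀₀ : UnitaryLike g₀₀) (h₁₀ : UnitaryLike g₁₀)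
    (h₀₁ : UnitaryLike g₀₁) (h₁₁ : UnitaryLike g₁₁) {P₀₀ P₁₀ P₀₁ P₁₁ B₀₀ B₁₀ B₀₁ B₁₁ : R}
    {δg δδg q γ γγ γγ' : ℝ} (hg : GridBnd (g₀₀ : R) g₁₀ g₀₁ g₁₁ 1 δg δδg)
    (hP : GridBnd (P₀₀ - 1) (P₁₀ - 1) (P₀₁ - 1) (P₁₁ - 1) q γ γγ) (hB : ‖B₁₁ - B₁₀ - B₀₁ + B₀₀‖ ≤ γγ') :
    ‖((g₁₁ : R) * P₁₁ * ↑g₁₁⁻¹ - B₁₁) - ((g₁₀ : R) * P₁₀ * ↑g₁₀⁻¹ - B₁₀) - ((g₀₁ : R) * P₀₁ * ↑g₀₁⁻¹ - B₀₁) +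
        ((g₀₀ : R) * P₀₀ * ↑g₀₀⁻¹ - B₀₀)‖ ≤ γγ + 4 * δg * γ + 2 * q * δδg + 4 * q * δg ^ 2 + γγ' := by
  have e : ((g₁₁ : R) * P₁₁ * ↑g₁₁⁻¹ - B₁₁) - ((g₁₀ : R) * P₁₀ * ↑g₁₀⁻¹ - B₁₀) -
        ((g₀₁ : R) * P₀₁ * ↑g₀₁⁻¹ - B₀₁) + ((g₀₀ : R) * P₀₀ * ↑g₀₀⁻¹ - B₀₀) =
      ((g₁₁ : R) * (P₁₁ - 1) * ↑g₁₁⁻¹ - (g₁₀ : R) * (P₁₀ - 1) * ↑g₁₀⁻¹ - (g₀₁ : R) * (P₀₁ - 1) * ↑g₀₁⁻¹ +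
          (g₀₀ : R) * (P₀₀ - 1) * ↑g₀₀⁻¹) - (B₁₁ - B₁₀ - B₀₁ + B₀₀) := by
    simp only [mul_sub, sub_mul, mul_one, Units.mul_inv]
    abel
  rw [e]
  have hK := (hg.mul hP).mul (hg.inv h₀₀ h₁₀ h₀₁ h₁₁)
  refine (norm_sub_le _ _).trans (add_le_add (hK.dd.trans (le_of_eq ?_)) hB)
  ring

end Algebra

/-! ## §1  [folklore] The second lattice differences of the relative comb gauge -/

section Gauge

variable [NormOneClass R]

omit [NormOneClass R] in
/-- [folklore] `e_ν(κ) ≥ 0`. -/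
theorem e_nonneg (ν κ : Fin d) : (0 : ℤ) ≤ e ν κ := by
  unfold e; by_cases h : κ = ν
  · subst h; simp
  · simp [h]

omit [NormOneClass R] in
/-- [folklore] A site squeezed coordinatewise between two sites of the block lies in the block. -/
theorem inBlock_of_le_of_le {L : ℕ} {z y w : Site d} (hy : InBlock L z y) (hw : InBlock L z w) (x : Site d)
    (h : ∀ κ, y κ ≤ x κ ∧ x κ ≤ w κ) : InBlock L z x :=
  fun κ => ⟨(hy κ).1.trans (h κ).1, lt_of_le_of_lt (h κ).2 (hw κ).2⟩

/-- [folklore] **THE MIXED SECOND DIFFERENCE OF THE COMB GAUGE** over the sites `x, x+e_μ, x+e_ρ, x+e_μ+e_ρ`: by the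
re-combing identity `g(·+e_μ) = U₀⟨·,μ⟩⁻¹W⟨·,μ⟩⁻¹·g(·)·U₁⟨·,μ⟩` (`T4RelativeCombGradient.combGauge_step`) at `x` and at
`x+e_ρ` this is the second difference of a two-sided step map (`norm_stepMap_dd_le`):
`‖Δ_μΔ_ρ g(x)‖ ≤ (γu + G) + (τ + w)(δ + γu₁) + δ·τ₁′ + γu₁` from `‖U₀⟨x+e_ρ,μ⟩ − U₀⟨x,μ⟩‖ ≤ γu`,
`‖W⟨x+e_ρ,μ⟩ − W⟨x,μ⟩‖ ≤ G`, `‖U₀⟨x,μ⟩ − 1‖ ≤ τ`, `‖W⟨x,μ⟩ − 1‖ ≤ w`, `‖g(x+e_ρ) − g(x)‖ ≤ δ`,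
`‖U₁⟨x+e_ρ,μ⟩ − U₁⟨x,μ⟩‖ ≤ γu₁`, `‖U₁⟨x+e_ρ,μ⟩ − 1‖ ≤ τ₁′` — SECOND ORDER (first differences of bond data, or
products of two first-order quantities). -/
theorem norm_combGauge_dd_le {U₀ U₁ : Cfg d R} (hU₀ : ∀ x ν, UnitaryLike (U₀ x ν))
    (hU₁ : ∀ x ν, UnitaryLike (U₁ x ν)) (z x : Site d) (μ ρ : Fin d) {γu G τ w δ γu₁ τ₁' : ℝ}
    (hγu : ‖(U₀ (x + e ρ) μ : R) - U₀ x μ‖ ≤ γu)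
    (hG : ‖(defect U₀ U₁ z (x + e ρ) μ : R) - defect U₀ U₁ z x μ‖ ≤ G)
    (hτ : ‖(U₀ x μ : R) - 1‖ ≤ τ) (hw : ‖(defect U₀ U₁ z x μ : R) - 1‖ ≤ w)
    (hδ : ‖(combGauge U₀ U₁ z (x + e ρ) : R) - combGauge U₀ U₁ z x‖ ≤ δ)
    (hγu₁ : ‖(U₁ (x + e ρ) μ : R) - U₁ x μ‖ ≤ γu₁) (hτ₁ : ‖(U₁ (x + e ρ) μ : R) - 1‖ ≤ τ₁') :
    ‖(combGauge U₀ U₁ z (x + e μ + e ρ) : R) - combGauge U₀ U₁ z (x + e μ) - combGauge U₀ U₁ z (x + e ρ) +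
        combGauge U₀ U₁ z x‖ ≤ (γu + G) + (τ + w) * (δ + γu₁) + δ * τ₁' + γu₁ := by
  have hg := unitaryLike_combGauge hU₀ hU₁ z
  rw [add_right_comm x (e μ) (e ρ), combGauge_step U₀ U₁ z (x + e ρ) μ, combGauge_step U₀ U₁ z x μ]
  push_cast
  rw [show (((U₀ (x + e ρ) μ)⁻¹ : Rˣ) : R) * (((defect U₀ U₁ z (x + e ρ) μ)⁻¹ : Rˣ) : R) *
        (combGauge U₀ U₁ z (x + e ρ) : R) * (U₁ (x + e ρ) μ : R) -
        (((U₀ x μ)⁻¹ : Rˣ) : R) * (((defect U₀ U₁ z x μ)⁻¹ : Rˣ) : R) * (combGauge U₀ U₁ z x : R) * (U₁ x μ : R) -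
        (combGauge U₀ U₁ z (x + e ρ) : R) + (combGauge U₀ U₁ z x : R) =
      ((((U₀ (x + e ρ) μ)⁻¹ : Rˣ) : R) * (((defect U₀ U₁ z (x + e ρ) μ)⁻¹ : Rˣ) : R) *
          (combGauge U₀ U₁ z (x + e ρ) : R) * (U₁ (x + e ρ) μ : R) - (combGauge U₀ U₁ z (x + e ρ) : R)) -
        ((((U₀ x μ)⁻¹ : Rˣ) : R) * (((defect U₀ U₁ z x μ)⁻¹ : Rˣ) : R) * (combGauge U₀ U₁ z x : R) * (U₁ x μ : R) -
          (combGauge U₀ U₁ z x : R)) by abel]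
  exact norm_stepMap_dd_le (hg x) (hg (x + e ρ)) (hU₁ (x + e ρ) μ)
    ((norm_invinv_sub_one_le (hU₀ x μ) (unitaryLike_defect hU₀ hU₁ z x μ)).trans (add_le_add hτ hw))
    ((norm_invinv_sub_invinv_le (hU₀ x μ) (hU₀ (x + e ρ) μ) (unitaryLike_defect hU₀ hU₁ z x μ)
      (unitaryLike_defect hU₀ hU₁ z (x + e ρ) μ)).trans (add_le_add hγu hG)) hδ hτ₁ hγu₁


/-- [folklore] THE ONE-BOND VARIATION LETTER of the comb gauge: `δ_g(C; s, τ₀, τ₁) = τ₀ + C·s + τ₁`. -/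
def gaugeStep (C s τ₀ τ₁ : ℝ) : ℝ := τ₀ + C * s + τ₁

/-- [folklore] THE SECOND-DIFFERENCE LETTER of the comb gauge:
`δδ_g(C; s, τ₀, τ₁, G, γU, γU₁) = (γU + G) + (τ₀ + C·s)(δ_g + γU₁) + δ_g·τ₁ + γU₁`. -/
def gaugeHess (C s τ₀ τ₁ G γU γU₁ : ℝ) : ℝ :=
  (γU + G) + (τ₀ + C * s) * (gaugeStep C s τ₀ τ₁ + γU₁) + gaugeStep C s τ₀ τ₁ * τ₁ + γU₁

/-- [folklore] `δ_g ≥ 0`. -/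
theorem gaugeStep_nonneg {C s τ₀ τ₁ : ℝ} (hC : 0 ≤ C) (hs : 0 ≤ s) (hτ0 : 0 ≤ τ₀) (hτ1 : 0 ≤ τ₁) :
    0 ≤ gaugeStep C s τ₀ τ₁ := by
  unfold gaugeStep; positivity

/-- [folklore] `δδ_g ≥ 0`. -/
theorem gaugeHess_nonneg {C s τ₀ τ₁ G γU γU₁ : ℝ} (hC : 0 ≤ C) (hs : 0 ≤ s) (hτ0 : 0 ≤ τ₀) (hτ1 : 0 ≤ τ₁)
    (hG : 0 ≤ G) (hγU : 0 ≤ γU) (hγU1 : 0 ≤ γU₁) : 0 ≤ gaugeHess C s τ₀ τ₁ G γU γU₁ := by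
  unfold gaugeHess gaugeStep; positivity

variable {L : ℕ} {z : Site d}

/-- [folklore] The one-bond variation of the comb gauge on an interior bond of the block, BLOCK-SUP FORM:
`‖g(x+e_μ) − g(x)‖ ≤ τ₀ + C·s + τ₁` (`T4RelativeCombGradient.norm_combGauge_step_sub_le` + the master count
`T4CombSecondDifference.norm_defect_sub_one_le`). -/
theorem norm_combGauge_sub_le {U₀ U₁ : Cfg d R} {s τ₀ τ₁ : ℝ} (hU₀ : ∀ x ν, UnitaryLike (U₀ x ν))
    (hU₁ : ∀ x ν, UnitaryLike (U₁ x ν))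
    (hs : PlaqSup L z (fun y ρ ν =>
      ‖(plaq (gaugeAct (combGauge U₀ U₁ z) U₁) y ρ ν : R) - plaq U₀ y ρ ν‖) s)
    (hτ₀ : ∀ x ρ, InBlock L z x → InBlock L z (x + e ρ) → ‖(U₀ x ρ : R) - 1‖ ≤ τ₀)
    (hτ₁ : ∀ x ρ, InBlock L z x → InBlock L z (x + e ρ) → ‖(U₁ x ρ : R) - 1‖ ≤ τ₁) (hs0 : 0 ≤ s)
    {x : Site d} {μ : Fin d} (hx : InBlock L z x) (hxμ : InBlock L z (x + e μ)) :
    ‖(combGauge U₀ U₁ z (x + e μ) : R) - combGauge U₀ U₁ z x‖ ≤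
      gaugeStep (((d : ℝ) - 1) * ((L : ℝ) - 1)) s τ₀ τ₁ :=
  (norm_combGauge_step_sub_le hU₀ hU₁ z x μ).trans (add_le_add (add_le_add (hτ₀ x μ hx hxμ)
    (norm_defect_sub_one_le hU₀ hU₁ hs hs0 hx hxμ)) (hτ₁ x μ hx hxμ))

/-- **THE MIXED SECOND DIFFERENCES OF THE COMB GAUGE ON A BLOCK, FROM RAW BLOCK SUPS** (`norm_combGauge_dd_le` fed
by the block sups): for `x, x+e_μ+e_ρ ∈ B(z)`,
`‖g(x+e_μ+e_ρ) − g(x+e_μ) − g(x+e_ρ) + g(x)‖ ≤ gaugeHess C s τ₀ τ₁ G γU γU₁`, `C = (d−1)(L−1)`, from the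
gauge-fixed deviation sup `s` (through the master count), the bond deviations `τ₀, τ₁`, the defect gradient `G`
(the datum of `T4RelativeCombGradient.norm_gradient_le(_raw)`), and the plain bond gradients `γU` (of `U₀`) and
`γU₁` (of `U₁`).  [folklore] -/
theorem norm_combGauge_dd_le_of_sup {U₀ U₁ : Cfg d R} {s τ₀ τ₁ G γU γU₁ : ℝ}
    (hU₀ : ∀ x ν, UnitaryLike (U₀ x ν)) (hU₁ : ∀ x ν, UnitaryLike (U₁ x ν))
    (hs : PlaqSup L z (fun y ρ ν =>
      ‖(plaq (gaugeAct (combGauge U₀ U₁ z) U₁) y ρ ν : R) - plaq U₀ y ρ ν‖) s)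
    (hτ₀ : ∀ x ρ, InBlock L z x → InBlock L z (x + e ρ) → ‖(U₀ x ρ : R) - 1‖ ≤ τ₀)
    (hτ₁ : ∀ x ρ, InBlock L z x → InBlock L z (x + e ρ) → ‖(U₁ x ρ : R) - 1‖ ≤ τ₁)
    (hG : ∀ μ ν x, InBlock L z x → InBlock L z (x + e μ) → InBlock L z (x + e μ + e ν) →
      ‖(defect U₀ U₁ z (x + e μ) ν : R) - defect U₀ U₁ z x ν‖ ≤ G)
    (hγU : ∀ μ x ρ, InBlock L z x → InBlock L z (x + e ρ) → InBlock L z (x + e μ) →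
      InBlock L z (x + e μ + e ρ) → ‖(U₀ (x + e μ) ρ : R) - U₀ x ρ‖ ≤ γU)
    (hγU₁ : ∀ μ x ρ, InBlock L z x → InBlock L z (x + e ρ) → InBlock L z (x + e μ) →
      InBlock L z (x + e μ + e ρ) → ‖(U₁ (x + e μ) ρ : R) - U₁ x ρ‖ ≤ γU₁)
    (hs0 : 0 ≤ s) {x : Site d} {μ ρ : Fin d} (hx : InBlock L z x) (hxμρ : InBlock L z (x + e μ + e ρ)) :
    ‖(combGauge U₀ U₁ z (x + e μ + e ρ) : R) - combGauge U₀ U₁ z (x + e μ) - combGauge U₀ U₁ z (x + e ρ) +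
        combGauge U₀ U₁ z x‖ ≤ gaugeHess (((d : ℝ) - 1) * ((L : ℝ) - 1)) s τ₀ τ₁ G γU γU₁ := by
  have hxμ : InBlock L z (x + e μ) := inBlock_of_le_of_le hx hxμρ _ fun κ => by
    simp only [Pi.add_apply]; have := e_nonneg (d := d) μ κ; have := e_nonneg (d := d) ρ κ; omega
  have hxρ : InBlock L z (x + e ρ) := inBlock_of_le_of_le hx hxμρ _ fun κ => by
    simp only [Pi.add_apply]; have := e_nonneg (d := d) μ κ; have := e_nonneg (d := d) ρ κ; omega
  have hxρμ : InBlock L z (x + e ρ + e μ) := by rwa [add_right_comm x (e μ) (e ρ)] at hxμρ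
  exact norm_combGauge_dd_le hU₀ hU₁ z x μ ρ (hγU ρ x μ hx hxμ hxρ hxρμ) (hG ρ μ x hx hxρ hxρμ) (hτ₀ x μ hx hxμ)
    (norm_defect_sub_one_le hU₀ hU₁ hs hs0 hx hxμ) (norm_combGauge_sub_le hU₀ hU₁ hs hτ₀ hτ₁ hs0 hx hxρ)
    (hγU₁ ρ x μ hx hxμ hxρ hxρμ) (hτ₁ (x + e ρ) μ hxρ hxρμ)

end Gauge

/-! ## §2  The second differences of the gauge-fixed deviation field from raw block sups -/

section Deviation

variable [NormOneClass R] {L : ℕ} {z : Site d}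

/-- [folklore] THE RAW SECOND-DIFFERENCE LETTER of the gauge-fixed deviation field (a polynomial in an ABSTRACT comb
count `C`): `γγE_raw = γγ₁ + 4δ_g·γ₁ + 2q₁·δδ_g + 4q₁·δ_g² + γγP` with `δ_g = gaugeStep C s τ₀ τ₁`,
`δδ_g = gaugeHess C s τ₀ τ₁ G γU γU₁`. -/
def devHessPoly (C s q₁ τ₀ τ₁ G γU γU₁ γ₁ γγP γγ₁ : ℝ) : ℝ :=
  γγ₁ + 4 * gaugeStep C s τ₀ τ₁ * γ₁ + 2 * q₁ * gaugeHess C s τ₀ τ₁ G γU γU₁ +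
    4 * q₁ * gaugeStep C s τ₀ τ₁ ^ 2 + γγP

omit [NormOneClass R] in
/-- [folklore] `γγE_raw ≥ 0` for nonnegative data. -/
theorem devHessPoly_nonneg {C s q₁ τ₀ τ₁ G γU γU₁ γ₁ γγP γγ₁ : ℝ} (hC : 0 ≤ C) (hs : 0 ≤ s) (hq1 : 0 ≤ q₁)
    (hτ0 : 0 ≤ τ₀) (hτ1 : 0 ≤ τ₁) (hG : 0 ≤ G) (hγU : 0 ≤ γU) (hγU1 : 0 ≤ γU₁) (hγ1 : 0 ≤ γ₁)
    (hγγP : 0 ≤ γγP) (hγγ1 : 0 ≤ γγ₁) : 0 ≤ devHessPoly C s q₁ τ₀ τ₁ G γU γU₁ γ₁ γγP γγ₁ := by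
  have := gaugeStep_nonneg hC hs hτ0 hτ1
  have := gaugeHess_nonneg hC hs hτ0 hτ1 hG hγU hγU1
  unfold devHessPoly; positivity

/-- **THE SECOND-DIFFERENCE INPUT `γγE` DISCHARGED FROM RAW DATA** — in EXACTLY the binder shape of the hypothesis
`hγγE` of `T4CombSecondDifference.norm_second_diff_le` / `windowData_comb_second(_raw)`.  On the block `B(z)`, for a
unitary-like pair, the MIXED second lattice difference `Δ_μΔ_ρ` of the gauge-fixed deviation field
`E = plaq(U₁^g) − plaq U₀` (`g` = the relative comb gauge) over plaquettes `(·; α, ν′)` with `y, y+e_μ+e_ρ+e_α+e_ν′ ∈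
B(z)` is `≤ devHessPoly C s q₁ τ₀ τ₁ G γU γU₁ γ₁ γγP γγ₁`, `C = (d−1)(L−1)`, from block sups of: the gauge-fixed
deviation `s`, the curvature `q₁` and bond deviation `τ₁` of `U₁`, the bond deviation `τ₀` of `U₀`, the defect
gradient `G`, the plain bond gradients `γU, γU₁`, the plaquette gradient `γ₁` of `U₁`, and the plain SECOND
differences `γγP` (base plaquettes) and `γγ₁` (`U₁` plaquettes).  Mechanism: `E = g(P₁ − 1)g⁻¹ − (P₀ − 1)` by gauge
covariance (`T4RelativeComb.plaq_gaugeAct`); the grid calculus of `T4CombSecondDifference` §0 (`norm_conjDev_dd_le`)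
with the comb-gauge grid `(1, δ_g, δδ_g)` of §1.  [folklore] -/
theorem deviation_second_le {U₀ U₁ : Cfg d R} {s q₁ τ₀ τ₁ G γU γU₁ γ₁ γγP γγ₁ : ℝ}
    (hU₀ : ∀ x ν, UnitaryLike (U₀ x ν)) (hU₁ : ∀ x ν, UnitaryLike (U₁ x ν))
    (hs : PlaqSup L z (fun y ρ ν =>
      ‖(plaq (gaugeAct (combGauge U₀ U₁ z) U₁) y ρ ν : R) - plaq U₀ y ρ ν‖) s)
    (hq₁ : PlaqSup L z (fun y ρ ν => ‖(plaq U₁ y ρ ν : R) - 1‖) q₁)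
    (hτ₀ : ∀ x ρ, InBlock L z x → InBlock L z (x + e ρ) → ‖(U₀ x ρ : R) - 1‖ ≤ τ₀)
    (hτ₁ : ∀ x ρ, InBlock L z x → InBlock L z (x + e ρ) → ‖(U₁ x ρ : R) - 1‖ ≤ τ₁)
    (hG : ∀ μ ν x, InBlock L z x → InBlock L z (x + e μ) → InBlock L z (x + e μ + e ν) →
      ‖(defect U₀ U₁ z (x + e μ) ν : R) - defect U₀ U₁ z x ν‖ ≤ G)
    (hγU : ∀ μ x ρ, InBlock L z x → InBlock L z (x + e ρ) → InBlock L z (x + e μ) →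
      InBlock L z (x + e μ + e ρ) → ‖(U₀ (x + e μ) ρ : R) - U₀ x ρ‖ ≤ γU)
    (hγU₁ : ∀ μ x ρ, InBlock L z x → InBlock L z (x + e ρ) → InBlock L z (x + e μ) →
      InBlock L z (x + e μ + e ρ) → ‖(U₁ (x + e μ) ρ : R) - U₁ x ρ‖ ≤ γU₁)
    (hγ₁ : ∀ μ y ρ ν', ρ ≠ ν' → InBlock L z y → InBlock L z (y + e ρ) → InBlock L z (y + e ν') →
      InBlock L z (y + e ρ + e ν') → InBlock L z (y + e μ) → InBlock L z (y + e μ + e ρ) →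
      InBlock L z (y + e μ + e ν') → InBlock L z (y + e μ + e ρ + e ν') →
      ‖(plaq U₁ (y + e μ) ρ ν' : R) - plaq U₁ y ρ ν'‖ ≤ γ₁)
    (hγγP : ∀ μ ρ y α ν', α ≠ ν' → InBlock L z y → InBlock L z (y + e μ + e ρ + e α + e ν') →
      ‖(plaq U₀ (y + e μ + e ρ) α ν' : R) - plaq U₀ (y + e μ) α ν' - plaq U₀ (y + e ρ) α ν' +
          plaq U₀ y α ν'‖ ≤ γγP)
    (hγγ₁ : ∀ μ ρ y α ν', α ≠ ν' → InBlock L z y → InBlock L z (y + e μ + e ρ + e α + e ν') →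
      ‖(plaq U₁ (y + e μ + e ρ) α ν' : R) - plaq U₁ (y + e μ) α ν' - plaq U₁ (y + e ρ) α ν' +
          plaq U₁ y α ν'‖ ≤ γγ₁)
    (hs0 : 0 ≤ s) :
    ∀ μ ρ y α ν', α ≠ ν' → InBlock L z y → InBlock L z (y + e μ + e ρ + e α + e ν') →
      ‖((plaq (gaugeAct (combGauge U₀ U₁ z) U₁) (y + e μ + e ρ) α ν' : R) - plaq U₀ (y + e μ + e ρ) α ν') -
          ((plaq (gaugeAct (combGauge U₀ U₁ z) U₁) (y + e μ) α ν' : R) - plaq U₀ (y + e μ) α ν') -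
          ((plaq (gaugeAct (combGauge U₀ U₁ z) U₁) (y + e ρ) α ν' : R) - plaq U₀ (y + e ρ) α ν') +
          ((plaq (gaugeAct (combGauge U₀ U₁ z) U₁) y α ν' : R) - plaq U₀ y α ν')‖ ≤
        devHessPoly (((d : ℝ) - 1) * ((L : ℝ) - 1)) s q₁ τ₀ τ₁ G γU γU₁ γ₁ γγP γγ₁ := by
  intro μ ρ y α ν' hne hy hfar
  have hg := unitaryLike_combGauge hU₀ hU₁ z
  -- block membership of the sub-corners of `y + e_μ + e_ρ + e_α + e_ν'`
  have cor : ∀ x : Site d, (∀ κ, y κ ≤ x κ ∧ x κ ≤ (y + e μ + e ρ + e α + e ν') κ) → InBlock L z x :=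
    inBlock_of_le_of_le hy hfar
  have cα : InBlock L z (y + e α) := cor _ fun κ => by
    simp only [Pi.add_apply]; have := e_nonneg (d := d) μ κ; have := e_nonneg (d := d) ρ κ
    have := e_nonneg (d := d) α κ; have := e_nonneg (d := d) ν' κ; omega
  have cν : InBlock L z (y + e ν') := cor _ fun κ => by
    simp only [Pi.add_apply]; have := e_nonneg (d := d) μ κ; have := e_nonneg (d := d) ρ κ
    have := e_nonneg (d := d) α κ; have := e_nonneg (d := d) ν' κ; omega
  have cαν : InBlock L z (y + e α + e ν') := cor _ fun κ => by
    simp only [Pi.add_apply]; have := e_nonneg (d := d) μ κ; have := e_nonneg (d := d) ρ κ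
    have := e_nonneg (d := d) α κ; have := e_nonneg (d := d) ν' κ; omega
  have cμ : InBlock L z (y + e μ) := cor _ fun κ => by
    simp only [Pi.add_apply]; have := e_nonneg (d := d) μ κ; have := e_nonneg (d := d) ρ κ
    have := e_nonneg (d := d) α κ; have := e_nonneg (d := d) ν' κ; omega
  have cμα : InBlock L z (y + e μ + e α) := cor _ fun κ => by
    simp only [Pi.add_apply]; have := e_nonneg (d := d) μ κ; have := e_nonneg (d := d) ρ κ
    have := e_nonneg (d := d) α κ; have := e_nonneg (d := d) ν' κ; omega
  have cμν : InBlock L z (y + e μ + e ν') := cor _ fun κ => by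
    simp only [Pi.add_apply]; have := e_nonneg (d := d) μ κ; have := e_nonneg (d := d) ρ κ
    have := e_nonneg (d := d) α κ; have := e_nonneg (d := d) ν' κ; omega
  have cμαν : InBlock L z (y + e μ + e α + e ν') := cor _ fun κ => by
    simp only [Pi.add_apply]; have := e_nonneg (d := d) μ κ; have := e_nonneg (d := d) ρ κ
    have := e_nonneg (d := d) α κ; have := e_nonneg (d := d) ν' κ; omega
  have cρ : InBlock L z (y + e ρ) := cor _ fun κ => by
    simp only [Pi.add_apply]; have := e_nonneg (d := d) μ κ; have := e_nonneg (d := d) ρ κ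
    have := e_nonneg (d := d) α κ; have := e_nonneg (d := d) ν' κ; omega
  have cρα : InBlock L z (y + e ρ + e α) := cor _ fun κ => by
    simp only [Pi.add_apply]; have := e_nonneg (d := d) μ κ; have := e_nonneg (d := d) ρ κ
    have := e_nonneg (d := d) α κ; have := e_nonneg (d := d) ν' κ; omega
  have cρν : InBlock L z (y + e ρ + e ν') := cor _ fun κ => by
    simp only [Pi.add_apply]; have := e_nonneg (d := d) μ κ; have := e_nonneg (d := d) ρ κ
    have := e_nonneg (d := d) α κ; have := e_nonneg (d := d) ν' κ; omega
  have cραν : InBlock L z (y + e ρ + e α + e ν') := cor _ fun κ => by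
    simp only [Pi.add_apply]; have := e_nonneg (d := d) μ κ; have := e_nonneg (d := d) ρ κ
    have := e_nonneg (d := d) α κ; have := e_nonneg (d := d) ν' κ; omega
  have cμρ : InBlock L z (y + e μ + e ρ) := cor _ fun κ => by
    simp only [Pi.add_apply]; have := e_nonneg (d := d) μ κ; have := e_nonneg (d := d) ρ κ
    have := e_nonneg (d := d) α κ; have := e_nonneg (d := d) ν' κ; omega
  have cμρα : InBlock L z (y + e μ + e ρ + e α) := cor _ fun κ => by
    simp only [Pi.add_apply]; have := e_nonneg (d := d) μ κ; have := e_nonneg (d := d) ρ κ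
    have := e_nonneg (d := d) α κ; have := e_nonneg (d := d) ν' κ; omega
  have cμρν : InBlock L z (y + e μ + e ρ + e ν') := cor _ fun κ => by
    simp only [Pi.add_apply]; have := e_nonneg (d := d) μ κ; have := e_nonneg (d := d) ρ κ
    have := e_nonneg (d := d) α κ; have := e_nonneg (d := d) ν' κ; omega
  have cρμ : InBlock L z (y + e ρ + e μ) := by rwa [add_right_comm y (e μ) (e ρ)] at cμρ
  have cρμα : InBlock L z (y + e ρ + e μ + e α) := by rwa [add_right_comm y (e μ) (e ρ)] at cμρα
  have cρμν : InBlock L z (y + e ρ + e μ + e ν') := by rwa [add_right_comm y (e μ) (e ρ)] at cμρν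
  have cρμαν : InBlock L z (y + e ρ + e μ + e α + e ν') := by rwa [add_right_comm y (e μ) (e ρ)] at hfar
  -- the grid of the comb gauge: `(1, δ_g, δδ_g)`
  have Gg : GridBnd (combGauge U₀ U₁ z y : R) (combGauge U₀ U₁ z (y + e μ)) (combGauge U₀ U₁ z (y + e ρ))
      (combGauge U₀ U₁ z (y + e μ + e ρ)) 1 (gaugeStep (((d : ℝ) - 1) * ((L : ℝ) - 1)) s τ₀ τ₁)
      (gaugeHess (((d : ℝ) - 1) * ((L : ℝ) - 1)) s τ₀ τ₁ G γU γU₁) := by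
    refine ⟨(hg _).1, (hg _).1, (hg _).1, (hg _).1, norm_combGauge_sub_le hU₀ hU₁ hs hτ₀ hτ₁ hs0 hy cμ, ?_,
      norm_combGauge_sub_le hU₀ hU₁ hs hτ₀ hτ₁ hs0 hy cρ, norm_combGauge_sub_le hU₀ hU₁ hs hτ₀ hτ₁ hs0 cμ cμρ,
      norm_combGauge_dd_le_of_sup hU₀ hU₁ hs hτ₀ hτ₁ hG hγU hγU₁ hs0 hy cμρ⟩
    have := norm_combGauge_sub_le hU₀ hU₁ hs hτ₀ hτ₁ hs0 cρ cρμ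
    rwa [add_right_comm y (e ρ) (e μ)] at this
  -- the grid of `P₁ − 1`: `(q₁, γ₁, γγ₁)`
  have GP : GridBnd ((plaq U₁ y α ν' : R) - 1) ((plaq U₁ (y + e μ) α ν' : R) - 1)
      ((plaq U₁ (y + e ρ) α ν' : R) - 1) ((plaq U₁ (y + e μ + e ρ) α ν' : R) - 1) q₁ γ₁ γγ₁ := by
    refine GridBnd.of_sub_const (hq₁ y α ν' hne hy cα cν cαν) (hq₁ _ α ν' hne cμ cμα cμν cμαν)
      (hq₁ _ α ν' hne cρ cρα cρν cραν) (hq₁ _ α ν' hne cμρ cμρα cμρν hfar)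
      (hγ₁ μ y α ν' hne hy cα cν cαν cμ cμα cμν cμαν) ?_ (hγ₁ ρ y α ν' hne hy cα cν cαν cρ cρα cρν cραν)
      (hγ₁ ρ (y + e μ) α ν' hne cμ cμα cμν cμαν cμρ cμρα cμρν hfar) (hγγ₁ μ ρ y α ν' hne hy hfar)
    have := hγ₁ μ (y + e ρ) α ν' hne cρ cρα cρν cραν cρμ cρμα cρμν cρμαν
    rwa [add_right_comm y (e ρ) (e μ)] at this
  simp only [plaq_gaugeAct]
  push_cast
  exact norm_conjDev_dd_le (hg _) (hg _) (hg _) (hg _) Gg GP (hγγP μ ρ y α ν' hne hy hfar)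

end Deviation

/-! ## §3  The window of `T4CombSecondDifference` §8 with `γγE` DISCHARGED: every letter a raw block sup -/

section Raw

variable [NormOneClass R] {L : ℕ} {z : Site d}

/-- **WINDOW DATA OF THE COMB DEFECT DEVIATION FROM RAW BLOCK SUPS ONLY** (`T4CombSecondDifference.windowData_comb_
second_raw` with its last composite letter `γγE` DISCHARGED BY NAME through `deviation_second_le`, the defect gradient
inside it by `T4RelativeCombGradient.norm_gradient_le_raw`): unitary-like pair, gauge-fixed relative plaquette
deviation `≤ s`, curvatures `≤ q₀, q₁`, bond deviations `≤ τ₀, τ₁`, plain bond gradients `≤ γU, γU₁`, plain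
plaquette gradients `≤ γ₀, γ₁`, plain second differences of base bonds `≤ γγU`, of base plaquettes `≤ γγP`, of the
`U₁` plaquettes `≤ γγ₁` on `B(z)` ⟹ window data `(C·s, G_raw + C·s·γU, (2(G_raw + C·s·γU))^{1−β}·σ^β)` with
`σ = secondDev C s q₀ τ₀ G_raw γU γ₀ γE_raw γγU γγP γγE_raw`,
`γγE_raw = devHessPoly C s q₁ τ₀ τ₁ G_raw γU γU₁ γ₁ γγP γγ₁`, `0 ≤ β ≤ 1`.  No composite letter is left: the twelve
inputs are block sups of norms of PLAIN lattice differences (orders 0, 1, 2) of the two configurations' bond and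
plaquette variables, plus the gauge-fixed deviation sup `s` of Lemma 1's format.  [folklore] -/
theorem windowData_comb_second_allRaw {U₀ U₁ : Cfg d R} {β s q₀ q₁ τ₀ τ₁ γU γU₁ γ₀ γ₁ γγU γγP γγ₁ : ℝ}
    (hβ0 : 0 ≤ β) (hβ1 : β ≤ 1) (hC : 0 ≤ ((d : ℝ) - 1) * ((L : ℝ) - 1))
    (hU₀ : ∀ x ν, UnitaryLike (U₀ x ν)) (hU₁ : ∀ x ν, UnitaryLike (U₁ x ν))
    (hs : PlaqSup L z (fun y ρ ν =>
      ‖(plaq (gaugeAct (combGauge U₀ U₁ z) U₁) y ρ ν : R) - plaq U₀ y ρ ν‖) s)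
    (hq₀ : PlaqSup L z (fun y ρ ν => ‖(plaq U₀ y ρ ν : R) - 1‖) q₀)
    (hq₁ : PlaqSup L z (fun y ρ ν => ‖(plaq U₁ y ρ ν : R) - 1‖) q₁)
    (hτ₀ : ∀ x ρ, InBlock L z x → InBlock L z (x + e ρ) → ‖(U₀ x ρ : R) - 1‖ ≤ τ₀)
    (hτ₁ : ∀ x ρ, InBlock L z x → InBlock L z (x + e ρ) → ‖(U₁ x ρ : R) - 1‖ ≤ τ₁)
    (hγU : ∀ μ x ρ, InBlock L z x → InBlock L z (x + e ρ) → InBlock L z (x + e μ) →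
      InBlock L z (x + e μ + e ρ) → ‖(U₀ (x + e μ) ρ : R) - U₀ x ρ‖ ≤ γU)
    (hγU₁ : ∀ μ x ρ, InBlock L z x → InBlock L z (x + e ρ) → InBlock L z (x + e μ) →
      InBlock L z (x + e μ + e ρ) → ‖(U₁ (x + e μ) ρ : R) - U₁ x ρ‖ ≤ γU₁)
    (hγ₀ : ∀ μ y ρ ν', ρ ≠ ν' → InBlock L z y → InBlock L z (y + e ρ) → InBlock L z (y + e ν') →
      InBlock L z (y + e ρ + e ν') → InBlock L z (y + e μ) → InBlock L z (y + e μ + e ρ) →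
      InBlock L z (y + e μ + e ν') → InBlock L z (y + e μ + e ρ + e ν') →
      ‖(plaq U₀ (y + e μ) ρ ν' : R) - plaq U₀ y ρ ν'‖ ≤ γ₀)
    (hγ₁ : ∀ μ y ρ ν', ρ ≠ ν' → InBlock L z y → InBlock L z (y + e ρ) → InBlock L z (y + e ν') →
      InBlock L z (y + e ρ + e ν') → InBlock L z (y + e μ) → InBlock L z (y + e μ + e ρ) →
      InBlock L z (y + e μ + e ν') → InBlock L z (y + e μ + e ρ + e ν') →
      ‖(plaq U₁ (y + e μ) ρ ν' : R) - plaq U₁ y ρ ν'‖ ≤ γ₁)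
    (hγγU : ∀ μ ρ x α, InBlock L z x → InBlock L z (x + e μ + e ρ + e α) →
      ‖(U₀ (x + e μ + e ρ) α : R) - U₀ (x + e μ) α - U₀ (x + e ρ) α + U₀ x α‖ ≤ γγU)
    (hγγP : ∀ μ ρ y α ν', α ≠ ν' → InBlock L z y → InBlock L z (y + e μ + e ρ + e α + e ν') →
      ‖(plaq U₀ (y + e μ + e ρ) α ν' : R) - plaq U₀ (y + e μ) α ν' - plaq U₀ (y + e ρ) α ν' +
          plaq U₀ y α ν'‖ ≤ γγP)
    (hγγ₁ : ∀ μ ρ y α ν', α ≠ ν' → InBlock L z y → InBlock L z (y + e μ + e ρ + e α + e ν') →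
      ‖(plaq U₁ (y + e μ + e ρ) α ν' : R) - plaq U₁ (y + e μ) α ν' - plaq U₁ (y + e ρ) α ν' +
          plaq U₁ y α ν'‖ ≤ γγ₁)
    (hs0 : 0 ≤ s) (hq0 : 0 ≤ q₀) (hq1 : 0 ≤ q₁) (hτ0 : 0 ≤ τ₀) (hτ1 : 0 ≤ τ₁) (hγU0 : 0 ≤ γU)
    (hγU10 : 0 ≤ γU₁) (hγ00 : 0 ≤ γ₀) (hγ10 : 0 ≤ γ₁) (hγγU0 : 0 ≤ γγU) (hγγP0 : 0 ≤ γγP) (hγγ10 : 0 ≤ γγ₁) :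
    WindowData L z β (blockDev L z (combGauge U₀ U₁ z) U₀ U₁)
      ⟨((d : ℝ) - 1) * ((L : ℝ) - 1) * s,
        gradRaw d L s q₀ q₁ τ₀ τ₁ γU γ₀ γ₁ + ((d : ℝ) - 1) * ((L : ℝ) - 1) * s * γU,
        (2 * (gradRaw d L s q₀ q₁ τ₀ τ₁ γU γ₀ γ₁ + ((d : ℝ) - 1) * ((L : ℝ) - 1) * s * γU)) ^ (1 - β) *
          (secondDev (((d : ℝ) - 1) * ((L : ℝ) - 1)) s q₀ τ₀ (gradRaw d L s q₀ q₁ τ₀ τ₁ γU γ₀ γ₁) γU γ₀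
            (devGradRaw d L s q₁ τ₀ τ₁ γ₀ γ₁) γγU γγP
            (devHessPoly (((d : ℝ) - 1) * ((L : ℝ) - 1)) s q₁ τ₀ τ₁ (gradRaw d L s q₀ q₁ τ₀ τ₁ γU γ₀ γ₁) γU γU₁
              γ₁ γγP γγ₁)) ^ β⟩ :=
  windowData_comb_second_raw hβ0 hβ1 hC hU₀ hU₁ hs hq₀ hq₁ hτ₀ hτ₁ hγU hγ₀ hγ₁ hγγU hγγP
    (deviation_second_le (G := gradRaw d L s q₀ q₁ τ₀ τ₁ γU γ₀ γ₁) hU₀ hU₁ hs hq₁ hτ₀ hτ₁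
      (fun μ ν x hx hxμ hxμν => T4RelativeCombGradient.norm_gradient_le_raw (μ := μ) (ν := ν) hU₀ hU₁ hs hq₀
        hq₁ hτ₀ hτ₁ (hγU μ) (hγ₀ μ) (hγ₁ μ) hs0 hq0 hq1 hτ0 hτ1 hγU0 hγ00 hγ10 x hx hxμ hxμν)
      hγU hγU₁ hγ₁ hγγP hγγ₁ hs0)
    hs0 hq0 hq1 hτ0 hτ1 hγU0 hγ00 hγ10 hγγU0 hγγP0
    (devHessPoly_nonneg hC hs0 hq1 hτ0 hτ1 (gradRaw_nonneg hC hs0 hq0 hq1 hτ0 hτ1 hγU0 hγ00 hγ10) hγU0 hγU10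
      hγ10 hγγP0 hγγ10)

variable [NormedAlgebra ℂ R] {F : Type*} [NormedAddCommGroup F] [NormedSpace ℂ F] [CompleteSpace F]
variable {Fn : Fld d R → F} {𝒦 : Set (Fld d R)} {w r A : ℝ} {β : ℝ} {κ : Win}

/-- **THE COMB INSTANCE OF THE WINDOW TRANSPORT FED BY RAW BLOCK SUPS ONLY**
(`T4CombHolderWindow.block_transport_window` on `windowData_comb_second_allRaw`): gauge-invariant `Fn` with a
WINDOW birth slice, unitary-like `U₀ ∈ 𝒦`, `U₁`, the twelve raw block sups, and the window triple `b` of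
`windowData_comb_second_allRaw` inside the window `N_κ(b) ≤ w` ⟹ `‖Fn U₁ − Fn U₀‖ ≤ (4A/r)·N_κ(b)`.  [folklore] -/
theorem block_transport_comb_window_second_allRaw (hinv : GaugeInvariant (BlockRel L z) Fn)
    (hsl : BirthSlice Fn (wMove L z β) (wN L z β κ) 𝒦 w r A) (hκ : κ.Pos) (hr : 0 < r) (hA : 0 ≤ A)
    {U₀ U₁ : Cfg d R} (hU₀𝒦 : val U₀ ∈ 𝒦) {s q₀ q₁ τ₀ τ₁ γU γU₁ γ₀ γ₁ γγU γγP γγ₁ : ℝ} (hβ0 : 0 ≤ β)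
    (hβ1 : β ≤ 1) (hC : 0 ≤ ((d : ℝ) - 1) * ((L : ℝ) - 1))
    (hU₀ : ∀ x ν, UnitaryLike (U₀ x ν)) (hU₁ : ∀ x ν, UnitaryLike (U₁ x ν))
    (hs : PlaqSup L z (fun y ρ ν =>
      ‖(plaq (gaugeAct (combGauge U₀ U₁ z) U₁) y ρ ν : R) - plaq U₀ y ρ ν‖) s)
    (hq₀ : PlaqSup L z (fun y ρ ν => ‖(plaq U₀ y ρ ν : R) - 1‖) q₀)
    (hq₁ : PlaqSup L z (fun y ρ ν => ‖(plaq U₁ y ρ ν : R) - 1‖) q₁)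
    (hτ₀ : ∀ x ρ, InBlock L z x → InBlock L z (x + e ρ) → ‖(U₀ x ρ : R) - 1‖ ≤ τ₀)
    (hτ₁ : ∀ x ρ, InBlock L z x → InBlock L z (x + e ρ) → ‖(U₁ x ρ : R) - 1‖ ≤ τ₁)
    (hγU : ∀ μ x ρ, InBlock L z x → InBlock L z (x + e ρ) → InBlock L z (x + e μ) →
      InBlock L z (x + e μ + e ρ) → ‖(U₀ (x + e μ) ρ : R) - U₀ x ρ‖ ≤ γU)
    (hγU₁ : ∀ μ x ρ, InBlock L z x → InBlock L z (x + e ρ) → InBlock L z (x + e μ) →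
      InBlock L z (x + e μ + e ρ) → ‖(U₁ (x + e μ) ρ : R) - U₁ x ρ‖ ≤ γU₁)
    (hγ₀ : ∀ μ y ρ ν', ρ ≠ ν' → InBlock L z y → InBlock L z (y + e ρ) → InBlock L z (y + e ν') →
      InBlock L z (y + e ρ + e ν') → InBlock L z (y + e μ) → InBlock L z (y + e μ + e ρ) →
      InBlock L z (y + e μ + e ν') → InBlock L z (y + e μ + e ρ + e ν') →
      ‖(plaq U₀ (y + e μ) ρ ν' : R) - plaq U₀ y ρ ν'‖ ≤ γ₀)
    (hγ₁ : ∀ μ y ρ ν', ρ ≠ ν' → InBlock L z y → InBlock L z (y + e ρ) → InBlock L z (y + e ν') →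
      InBlock L z (y + e ρ + e ν') → InBlock L z (y + e μ) → InBlock L z (y + e μ + e ρ) →
      InBlock L z (y + e μ + e ν') → InBlock L z (y + e μ + e ρ + e ν') →
      ‖(plaq U₁ (y + e μ) ρ ν' : R) - plaq U₁ y ρ ν'‖ ≤ γ₁)
    (hγγU : ∀ μ ρ x α, InBlock L z x → InBlock L z (x + e μ + e ρ + e α) →
      ‖(U₀ (x + e μ + e ρ) α : R) - U₀ (x + e μ) α - U₀ (x + e ρ) α + U₀ x α‖ ≤ γγU)
    (hγγP : ∀ μ ρ y α ν', α ≠ ν' → InBlock L z y → InBlock L z (y + e μ + e ρ + e α + e ν') →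
      ‖(plaq U₀ (y + e μ + e ρ) α ν' : R) - plaq U₀ (y + e μ) α ν' - plaq U₀ (y + e ρ) α ν' +
          plaq U₀ y α ν'‖ ≤ γγP)
    (hγγ₁ : ∀ μ ρ y α ν', α ≠ ν' → InBlock L z y → InBlock L z (y + e μ + e ρ + e α + e ν') →
      ‖(plaq U₁ (y + e μ + e ρ) α ν' : R) - plaq U₁ (y + e μ) α ν' - plaq U₁ (y + e ρ) α ν' +
          plaq U₁ y α ν'‖ ≤ γγ₁)
    (hs0 : 0 ≤ s) (hq0 : 0 ≤ q₀) (hq1 : 0 ≤ q₁) (hτ0 : 0 ≤ τ₀) (hτ1 : 0 ≤ τ₁) (hγU0 : 0 ≤ γU)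
    (hγU10 : 0 ≤ γU₁) (hγ00 : 0 ≤ γ₀) (hγ10 : 0 ≤ γ₁) (hγγU0 : 0 ≤ γγU) (hγγP0 : 0 ≤ γγP) (hγγ10 : 0 ≤ γγ₁)
    (hbw : winN κ ⟨((d : ℝ) - 1) * ((L : ℝ) - 1) * s,
        gradRaw d L s q₀ q₁ τ₀ τ₁ γU γ₀ γ₁ + ((d : ℝ) - 1) * ((L : ℝ) - 1) * s * γU,
        (2 * (gradRaw d L s q₀ q₁ τ₀ τ₁ γU γ₀ γ₁ + ((d : ℝ) - 1) * ((L : ℝ) - 1) * s * γU)) ^ (1 - β) *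
          (secondDev (((d : ℝ) - 1) * ((L : ℝ) - 1)) s q₀ τ₀ (gradRaw d L s q₀ q₁ τ₀ τ₁ γU γ₀ γ₁) γU γ₀
            (devGradRaw d L s q₁ τ₀ τ₁ γ₀ γ₁) γγU γγP
            (devHessPoly (((d : ℝ) - 1) * ((L : ℝ) - 1)) s q₁ τ₀ τ₁ (gradRaw d L s q₀ q₁ τ₀ τ₁ γU γ₀ γ₁) γU γU₁
              γ₁ γγP γγ₁)) ^ β⟩ ≤ w) :
    ‖Fn (val U₁) - Fn (val U₀)‖ ≤ 4 * A / r *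
      winN κ ⟨((d : ℝ) - 1) * ((L : ℝ) - 1) * s,
        gradRaw d L s q₀ q₁ τ₀ τ₁ γU γ₀ γ₁ + ((d : ℝ) - 1) * ((L : ℝ) - 1) * s * γU,
        (2 * (gradRaw d L s q₀ q₁ τ₀ τ₁ γU γ₀ γ₁ + ((d : ℝ) - 1) * ((L : ℝ) - 1) * s * γU)) ^ (1 - β) *
          (secondDev (((d : ℝ) - 1) * ((L : ℝ) - 1)) s q₀ τ₀ (gradRaw d L s q₀ q₁ τ₀ τ₁ γU γ₀ γ₁) γU γ₀
            (devGradRaw d L s q₁ τ₀ τ₁ γ₀ γ₁) γγU γγP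
            (devHessPoly (((d : ℝ) - 1) * ((L : ℝ) - 1)) s q₁ τ₀ τ₁ (gradRaw d L s q₀ q₁ τ₀ τ₁ γU γ₀ γ₁) γU γU₁
              γ₁ γγP γγ₁)) ^ β⟩ :=
  block_transport_window hinv hsl hκ hr hA hU₀𝒦 (unitaryLike_combGauge hU₀ hU₁ z)
    (windowData_comb_second_allRaw hβ0 hβ1 hC hU₀ hU₁ hs hq₀ hq₁ hτ₀ hτ₁ hγU hγU₁ hγ₀ hγ₁ hγγU hγγP hγγ₁ hs0 hq0
      hq1 hτ0 hτ1 hγU0 hγU10 hγ00 hγ10 hγγU0 hγγP0 hγγ10) hbw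

end Raw

/-! ### [arith] the composed rate under the plaquette-level dictionary `D₃`

`D₃` (cell reading, as `D₂` of `T4CombSecondDifference` §8 with the two new letters and the base-plaquette second
difference at its natural rate): `0 < θ ≤ 1 ≤ c`, `Cθ ≤ c`, `s, q₀, q₁, γU, γU₁ ≤ cθ²`, `τ₀, τ₁ ≤ cθ`,
`γ₀, γ₁, γγU ≤ cθ³`, `γγP, γγ₁ ≤ cθ⁴` (each plain lattice difference of plaquette data one power of `θ` up:
`q ~ θ²`, `γ ~ θ³`, `γγ ~ θ⁴`).  Then `δ_g ≤ 3c²θ`, `δδ_g ≤ 34c⁴θ²`, `γγE_raw ≤ 118c⁵θ⁴`, so the dictionary `D₂` of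
`T4CombSecondDifference.secondDev_raw_le_rate` holds with the constant `c″ = 118c⁵` — the σ-slot at `θ³` and the
whole window inside a `θ`-INDEPENDENT multiple of the printed window, now with NO composite letter among the
hypotheses.  Constants not optimised.  LOCATED AUDIT (v1.1): which letters of `D₃` have printed sup counterparts,
and what the interpolation yields under printed-type second-order inputs instead, is §6. -/

section RawRate

variable {θ c C s q₀ q₁ τ₀ τ₁ G γU γU₁ γ₀ γ₁ γγU γγP γγ₁ : ℝ}

/-- [folklore] (arith) `C·s ≤ c²θ` under `Cθ ≤ c`, `s ≤ cθ²`. -/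
theorem Cs_le_rate (hθ0 : 0 ≤ θ) (hc1 : 1 ≤ c) (hC0 : 0 ≤ C) (hCθ : C * θ ≤ c) (hs : s ≤ c * θ ^ 2) :
    C * s ≤ c ^ 2 * θ := by
  have hc0 : 0 ≤ c := by linarith
  calc C * s ≤ C * (c * θ ^ 2) := mul_le_mul_of_nonneg_left hs hC0
    _ = (C * θ) * (c * θ) := by ring
    _ ≤ c * (c * θ) := mul_le_mul_of_nonneg_right hCθ (by positivity)
    _ = c ^ 2 * θ := by ring

/-- **`δ_g = O(θ)` UNDER `D₃`** (arith): `gaugeStep C s τ₀ τ₁ ≤ 3c²θ`.  [folklore] -/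
theorem gaugeStep_le_rate (hθ0 : 0 ≤ θ) (hc1 : 1 ≤ c) (hC0 : 0 ≤ C) (hCθ : C * θ ≤ c) (hs : s ≤ c * θ ^ 2)
    (hτ₀ : τ₀ ≤ c * θ) (hτ₁ : τ₁ ≤ c * θ) : gaugeStep C s τ₀ τ₁ ≤ 3 * c ^ 2 * θ := by
  have hCs := Cs_le_rate hθ0 hc1 hC0 hCθ hs
  have hcθ : c * θ ≤ c ^ 2 * θ := mul_le_mul_of_nonneg_right (by nlinarith) hθ0
  unfold gaugeStep; linarith

/-- **`δδ_g = O(θ²)` UNDER `D₃`** (arith): with `G ≤ 21c⁴θ²` (the rate of `G_raw`,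
`T4CombSecondDifference.gradPoly_le_rate`), `gaugeHess C s τ₀ τ₁ G γU γU₁ ≤ 34c⁴θ²`.  [folklore] -/
theorem gaugeHess_le_rate (hθ0 : 0 ≤ θ) (hθ1 : θ ≤ 1) (hc1 : 1 ≤ c) (hC0 : 0 ≤ C) (hs0 : 0 ≤ s) (hτ0 : 0 ≤ τ₀)
    (hτ1 : 0 ≤ τ₁) (hγU10 : 0 ≤ γU₁) (hCθ : C * θ ≤ c) (hs : s ≤ c * θ ^ 2) (hτ₀ : τ₀ ≤ c * θ)
    (hτ₁ : τ₁ ≤ c * θ) (hG : G ≤ 21 * c ^ 4 * θ ^ 2) (hγU : γU ≤ c * θ ^ 2) (hγU₁ : γU₁ ≤ c * θ ^ 2) :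
    gaugeHess C s τ₀ τ₁ G γU γU₁ ≤ 34 * c ^ 4 * θ ^ 2 := by
  have hc0 : 0 ≤ c := by linarith
  have hδ := gaugeStep_le_rate hθ0 hc1 hC0 hCθ hs hτ₀ hτ₁
  have hδ0 := gaugeStep_nonneg hC0 hs0 hτ0 hτ1
  have hCs := Cs_le_rate hθ0 hc1 hC0 hCθ hs
  have hθ2 : θ ^ 2 ≤ θ := by nlinarith
  have hc2 : c ≤ c ^ 2 := by nlinarith
  have hc4 : c ≤ c ^ 4 := le_self_pow₀ hc1 (by norm_num)
  have hc34 : c ^ 3 ≤ c ^ 4 := pow_le_pow_right₀ hc1 (by norm_num)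
  have hcθ : c * θ ≤ c ^ 2 * θ := mul_le_mul_of_nonneg_right hc2 hθ0
  have hA : τ₀ + C * s ≤ 2 * c ^ 2 * θ := by linarith
  have hγU₁' : γU₁ ≤ c ^ 2 * θ :=
    hγU₁.trans ((mul_le_mul_of_nonneg_left hθ2 hc0).trans (mul_le_mul_of_nonneg_right hc2 hθ0))
  have hB : gaugeStep C s τ₀ τ₁ + γU₁ ≤ 4 * c ^ 2 * θ := by linarith
  have hAB : (τ₀ + C * s) * (gaugeStep C s τ₀ τ₁ + γU₁) ≤ 8 * c ^ 4 * θ ^ 2 :=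
    (mul_le_mul hA hB (by positivity) (by positivity)).trans_eq (by ring)
  have hδτ : gaugeStep C s τ₀ τ₁ * τ₁ ≤ 3 * c ^ 4 * θ ^ 2 :=
    ((mul_le_mul hδ hτ₁ hτ1 (by positivity)).trans_eq (by ring)).trans
      (mul_le_mul_of_nonneg_right (mul_le_mul_of_nonneg_left hc34 (by norm_num)) (by positivity))
  have hγU' : γU ≤ c ^ 4 * θ ^ 2 := hγU.trans (mul_le_mul_of_nonneg_right hc4 (by positivity))
  have hγU₁'' : γU₁ ≤ c ^ 4 * θ ^ 2 := hγU₁.trans (mul_le_mul_of_nonneg_right hc4 (by positivity))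
  unfold gaugeHess; linarith

/-- **`γγE_raw = O(θ⁴)` UNDER `D₃`** (arith): with `G ≤ 21c⁴θ²`,
`devHessPoly C s q₁ τ₀ τ₁ G γU γU₁ γ₁ γγP γγ₁ ≤ 118c⁵θ⁴` (`1 + 12 + 68 + 36 + 1`).  [folklore] -/
theorem devHessPoly_le_rate (hθ0 : 0 ≤ θ) (hθ1 : θ ≤ 1) (hc1 : 1 ≤ c) (hC0 : 0 ≤ C) (hs0 : 0 ≤ s)
    (hτ0 : 0 ≤ τ₀) (hτ1 : 0 ≤ τ₁) (hG0 : 0 ≤ G) (hγU0 : 0 ≤ γU) (hγU10 : 0 ≤ γU₁) (hγ10 : 0 ≤ γ₁)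
    (hCθ : C * θ ≤ c) (hs : s ≤ c * θ ^ 2) (hq₁ : q₁ ≤ c * θ ^ 2) (hτ₀ : τ₀ ≤ c * θ) (hτ₁ : τ₁ ≤ c * θ)
    (hG : G ≤ 21 * c ^ 4 * θ ^ 2)
    (hγU : γU ≤ c * θ ^ 2) (hγU₁ : γU₁ ≤ c * θ ^ 2) (hγ₁ : γ₁ ≤ c * θ ^ 3) (hγγP : γγP ≤ c * θ ^ 4)
    (hγγ₁ : γγ₁ ≤ c * θ ^ 4) :
    devHessPoly C s q₁ τ₀ τ₁ G γU γU₁ γ₁ γγP γγ₁ ≤ 118 * c ^ 5 * θ ^ 4 := by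
  have hc0 : 0 ≤ c := by linarith
  have hδ := gaugeStep_le_rate hθ0 hc1 hC0 hCθ hs hτ₀ hτ₁
  have hδ0 := gaugeStep_nonneg hC0 hs0 hτ0 hτ1
  have hδδ := gaugeHess_le_rate hθ0 hθ1 hc1 hC0 hs0 hτ0 hτ1 hγU10 hCθ hs hτ₀ hτ₁ hG hγU hγU₁
  have hc5 : c ≤ c ^ 5 := le_self_pow₀ hc1 (by norm_num)
  have hc35 : c ^ 3 ≤ c ^ 5 := pow_le_pow_right₀ hc1 (by norm_num)
  have m1 : γγ₁ ≤ c ^ 5 * θ ^ 4 := hγγ₁.trans (mul_le_mul_of_nonneg_right hc5 (by positivity))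
  have m5 : γγP ≤ c ^ 5 * θ ^ 4 := hγγP.trans (mul_le_mul_of_nonneg_right hc5 (by positivity))
  have m2 : 4 * gaugeStep C s τ₀ τ₁ * γ₁ ≤ 12 * c ^ 5 * θ ^ 4 := by
    have h : gaugeStep C s τ₀ τ₁ * γ₁ ≤ 3 * c ^ 3 * θ ^ 4 :=
      (mul_le_mul hδ hγ₁ hγ10 (by positivity)).trans_eq (by ring)
    have h' : 3 * c ^ 3 * θ ^ 4 ≤ 3 * c ^ 5 * θ ^ 4 :=
      mul_le_mul_of_nonneg_right (mul_le_mul_of_nonneg_left hc35 (by norm_num)) (by positivity)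
    linarith
  have m3 : 2 * q₁ * gaugeHess C s τ₀ τ₁ G γU γU₁ ≤ 68 * c ^ 5 * θ ^ 4 := by
    have h : q₁ * gaugeHess C s τ₀ τ₁ G γU γU₁ ≤ 34 * c ^ 5 * θ ^ 4 :=
      (mul_le_mul hq₁ hδδ (gaugeHess_nonneg hC0 hs0 hτ0 hτ1 hG0 hγU0 hγU10) (by positivity)).trans_eq (by ring)
    linarith
  have m4 : 4 * q₁ * gaugeStep C s τ₀ τ₁ ^ 2 ≤ 36 * c ^ 5 * θ ^ 4 := by
    have hsq : gaugeStep C s τ₀ τ₁ ^ 2 ≤ (3 * c ^ 2 * θ) ^ 2 := pow_le_pow_left₀ hδ0 hδ 2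
    have h : q₁ * gaugeStep C s τ₀ τ₁ ^ 2 ≤ 9 * c ^ 5 * θ ^ 4 :=
      (mul_le_mul hq₁ hsq (by positivity) (by positivity)).trans_eq (by ring)
    linarith
  unfold devHessPoly; linarith

/-- **THE ALL-RAW SECOND-DIFFERENCE DATUM IS `O(θ³)` UNDER `D₃`** (arith, cell reading; the COMPOSITION typed as one
theorem): under `D₃` the dictionary `D₂` of `T4CombSecondDifference.secondDev_raw_le_rate` holds with the constant
`c″ = 118c⁵` (`γγE_raw ≤ 118c⁵θ⁴ = c″θ⁴` by `devHessPoly_le_rate` with `G := G_raw ≤ 21c⁴θ²`, every other letter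
lifted from `c` to `c″`, `γγP ≤ cθ⁴ ≤ c″θ³`), hence
`σ = secondDev C s q₀ τ₀ G_raw γU γ₀ γE_raw γγU γγP γγE_raw ≤ 73·(21·(118c⁵)⁴)⁴·θ³`.  [folklore] -/
theorem secondDev_allRaw_le_rate (hθ0 : 0 ≤ θ) (hθ1 : θ ≤ 1) (hc1 : 1 ≤ c) (hC0 : 0 ≤ C) (hs0 : 0 ≤ s)
    (hq0 : 0 ≤ q₀) (hq1 : 0 ≤ q₁) (hτ0 : 0 ≤ τ₀) (hτ1 : 0 ≤ τ₁) (hγU0 : 0 ≤ γU) (hγU10 : 0 ≤ γU₁)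
    (hγ00 : 0 ≤ γ₀) (hγ10 : 0 ≤ γ₁) (hγγU0 : 0 ≤ γγU) (hγγP0 : 0 ≤ γγP) (hγγ10 : 0 ≤ γγ₁) (hCθ : C * θ ≤ c)
    (hs : s ≤ c * θ ^ 2) (hq₀ : q₀ ≤ c * θ ^ 2) (hq₁ : q₁ ≤ c * θ ^ 2) (hτ₀ : τ₀ ≤ c * θ) (hτ₁ : τ₁ ≤ c * θ)
    (hγU : γU ≤ c * θ ^ 2) (hγU₁ : γU₁ ≤ c * θ ^ 2) (hγ₀ : γ₀ ≤ c * θ ^ 3) (hγ₁ : γ₁ ≤ c * θ ^ 3)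
    (hγγU3 : γγU ≤ c * θ ^ 3) (hγγP4 : γγP ≤ c * θ ^ 4) (hγγ₁4 : γγ₁ ≤ c * θ ^ 4) :
    secondDev C s q₀ τ₀ (gradPoly C s q₀ q₁ τ₀ τ₁ γU γ₀ γ₁) γU γ₀ (devGradPoly C s q₁ τ₀ τ₁ γ₀ γ₁) γγU γγP
        (devHessPoly C s q₁ τ₀ τ₁ (gradPoly C s q₀ q₁ τ₀ τ₁ γU γ₀ γ₁) γU γU₁ γ₁ γγP γγ₁) ≤
      73 * (21 * (118 * c ^ 5) ^ 4) ^ 4 * θ ^ 3 := by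
  have hc0 : 0 ≤ c := by linarith
  have hc5 : c ≤ c ^ 5 := le_self_pow₀ hc1 (by norm_num)
  have hcc : c ≤ 118 * c ^ 5 := by linarith
  have hc1' : 1 ≤ 118 * c ^ 5 := hc1.trans hcc
  have lift : ∀ {x : ℝ} {k : ℕ}, x ≤ c * θ ^ k → x ≤ 118 * c ^ 5 * θ ^ k := fun {x k} hx =>
    hx.trans (mul_le_mul_of_nonneg_right hcc (pow_nonneg hθ0 k))
  have hτ₀' : τ₀ ≤ 118 * c ^ 5 * θ := hτ₀.trans (mul_le_mul_of_nonneg_right hcc hθ0)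
  have hτ₁' : τ₁ ≤ 118 * c ^ 5 * θ := hτ₁.trans (mul_le_mul_of_nonneg_right hcc hθ0)
  have hG := gradPoly_le_rate hθ0 hθ1 hc1 hC0 hs0 hq0 hτ0 hτ1 hCθ hs hq₀ hq₁ hτ₀ hτ₁ hγU hγ₀ hγ₁
  have hG0 := gradPoly_nonneg hC0 hs0 hq0 hq1 hτ0 hτ1 hγU0 hγ00 hγ10
  have hE : devHessPoly C s q₁ τ₀ τ₁ (gradPoly C s q₀ q₁ τ₀ τ₁ γU γ₀ γ₁) γU γU₁ γ₁ γγP γγ₁ ≤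
      118 * c ^ 5 * θ ^ 4 :=
    devHessPoly_le_rate hθ0 hθ1 hc1 hC0 hs0 hτ0 hτ1 hG0 hγU0 hγU10 hγ10 hCθ hs hq₁ hτ₀ hτ₁ hG hγU hγU₁ hγ₁
      hγγP4 hγγ₁4
  have hγγP3 : γγP ≤ 118 * c ^ 5 * θ ^ 3 :=
    (hγγP4.trans (mul_le_mul_of_nonneg_left (pow_le_pow_of_le_one hθ0 hθ1 (by norm_num)) hc0)).trans
      (mul_le_mul_of_nonneg_right hcc (pow_nonneg hθ0 3))
  exact secondDev_raw_le_rate hθ0 hθ1 hc1' hC0 hs0 hq0 hq1 hτ0 hτ1 hγU0 hγ00 hγ10 hγγU0 hγγP0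
    (devHessPoly_nonneg hC0 hs0 hq1 hτ0 hτ1 hG0 hγU0 hγU10 hγ10 hγγP0 hγγ10) (hCθ.trans hcc) (lift hs)
    (lift hq₀) (lift hq₁) hτ₀' hτ₁' (lift hγU) (lift hγ₀) (lift hγ₁) (lift hγγU3) hγγP3 hE

/-- **THE ALL-RAW WINDOW INSIDE A `θ`-INDEPENDENT MULTIPLE OF THE PRINTED WINDOW** (arith, cell reading; the composed
form of `T4CombSecondDifference.winN_printWin_second_raw_le` at `c″ = 118c⁵`): under `D₃` with `0 < θ ≤ 1`,
`0 ≤ β ≤ 1`, the window triple `b` of `windowData_comb_second_allRaw` (with `G_raw`, `γE_raw` read through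
`T4CombSecondDifference.gradRaw_eq_gradPoly`, `devGradRaw_eq_devGradPoly`) satisfies
`N_{κ(θ)}(b) ≤ a(21c″⁴, β) = 21c″⁴ + 2(21c″⁴)² + (4(21c″⁴)²)^{1−β}(73(21c″⁴)⁴)^β`, `c″ = 118c⁵`, for the printed
weights `κ(θ) = (θ, θ², θ^{2+β})`, UNIFORMLY in `θ`.  [folklore] -/
theorem winN_printWin_second_allRaw_le {β : ℝ} (hθ : 0 < θ) (hθ1 : θ ≤ 1) (hβ0 : 0 ≤ β) (hβ1 : β ≤ 1)
    (hc1 : 1 ≤ c) (hC0 : 0 ≤ C) (hs0 : 0 ≤ s) (hq0 : 0 ≤ q₀) (hq1 : 0 ≤ q₁) (hτ0 : 0 ≤ τ₀) (hτ1 : 0 ≤ τ₁)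
    (hγU0 : 0 ≤ γU) (hγU10 : 0 ≤ γU₁) (hγ00 : 0 ≤ γ₀) (hγ10 : 0 ≤ γ₁) (hγγU0 : 0 ≤ γγU) (hγγP0 : 0 ≤ γγP)
    (hγγ10 : 0 ≤ γγ₁) (hCθ : C * θ ≤ c) (hs : s ≤ c * θ ^ 2) (hq₀ : q₀ ≤ c * θ ^ 2) (hq₁ : q₁ ≤ c * θ ^ 2)
    (hτ₀ : τ₀ ≤ c * θ) (hτ₁ : τ₁ ≤ c * θ) (hγU : γU ≤ c * θ ^ 2) (hγU₁ : γU₁ ≤ c * θ ^ 2)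
    (hγ₀ : γ₀ ≤ c * θ ^ 3) (hγ₁ : γ₁ ≤ c * θ ^ 3) (hγγU3 : γγU ≤ c * θ ^ 3) (hγγP4 : γγP ≤ c * θ ^ 4)
    (hγγ₁4 : γγ₁ ≤ c * θ ^ 4) :
    winN (printWin θ β) ⟨C * s, gradPoly C s q₀ q₁ τ₀ τ₁ γU γ₀ γ₁ + C * s * γU,
        (2 * (gradPoly C s q₀ q₁ τ₀ τ₁ γU γ₀ γ₁ + C * s * γU)) ^ (1 - β) *
          (secondDev C s q₀ τ₀ (gradPoly C s q₀ q₁ τ₀ τ₁ γU γ₀ γ₁) γU γ₀ (devGradPoly C s q₁ τ₀ τ₁ γ₀ γ₁)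
            γγU γγP (devHessPoly C s q₁ τ₀ τ₁ (gradPoly C s q₀ q₁ τ₀ τ₁ γU γ₀ γ₁) γU γU₁ γ₁ γγP γγ₁)) ^ β⟩ ≤
      21 * (118 * c ^ 5) ^ 4 + 2 * (21 * (118 * c ^ 5) ^ 4) ^ 2 +
        (2 * (2 * (21 * (118 * c ^ 5) ^ 4) ^ 2)) ^ (1 - β) * (73 * (21 * (118 * c ^ 5) ^ 4) ^ 4) ^ β := by
  have hθ0 := hθ.le
  have hc0 : 0 ≤ c := by linarith
  have hc5 : c ≤ c ^ 5 := le_self_pow₀ hc1 (by norm_num)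
  have hcc : c ≤ 118 * c ^ 5 := by linarith
  have hc1' : 1 ≤ 118 * c ^ 5 := hc1.trans hcc
  have lift : ∀ {x : ℝ} {k : ℕ}, x ≤ c * θ ^ k → x ≤ 118 * c ^ 5 * θ ^ k := fun {x k} hx =>
    hx.trans (mul_le_mul_of_nonneg_right hcc (pow_nonneg hθ0 k))
  have hτ₀' : τ₀ ≤ 118 * c ^ 5 * θ := hτ₀.trans (mul_le_mul_of_nonneg_right hcc hθ0)
  have hτ₁' : τ₁ ≤ 118 * c ^ 5 * θ := hτ₁.trans (mul_le_mul_of_nonneg_right hcc hθ0)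
  have hG := gradPoly_le_rate hθ0 hθ1 hc1 hC0 hs0 hq0 hτ0 hτ1 hCθ hs hq₀ hq₁ hτ₀ hτ₁ hγU hγ₀ hγ₁
  have hG0 := gradPoly_nonneg hC0 hs0 hq0 hq1 hτ0 hτ1 hγU0 hγ00 hγ10
  have hE : devHessPoly C s q₁ τ₀ τ₁ (gradPoly C s q₀ q₁ τ₀ τ₁ γU γ₀ γ₁) γU γU₁ γ₁ γγP γγ₁ ≤
      118 * c ^ 5 * θ ^ 4 :=
    devHessPoly_le_rate hθ0 hθ1 hc1 hC0 hs0 hτ0 hτ1 hG0 hγU0 hγU10 hγ10 hCθ hs hq₁ hτ₀ hτ₁ hG hγU hγU₁ hγ₁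
      hγγP4 hγγ₁4
  have hγγP3 : γγP ≤ 118 * c ^ 5 * θ ^ 3 :=
    (hγγP4.trans (mul_le_mul_of_nonneg_left (pow_le_pow_of_le_one hθ0 hθ1 (by norm_num)) hc0)).trans
      (mul_le_mul_of_nonneg_right hcc (pow_nonneg hθ0 3))
  exact winN_printWin_second_raw_le hθ hθ1 hβ0 hβ1 hc1' hC0 hs0 hq0 hq1 hτ0 hτ1 hγU0 hγ00 hγ10 hγγU0 hγγP0
    (devHessPoly_nonneg hC0 hs0 hq1 hτ0 hτ1 hG0 hγU0 hγU10 hγ10 hγγP0 hγγ10) (hCθ.trans hcc) (lift hs)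
    (lift hq₀) (lift hq₁) hτ₀' hτ₁' (lift hγU) (lift hγ₀) (lift hγ₁) (lift hγγU3) hγγP3 hE

end RawRate

/-! ## §5  Non-vacuity -/

section Witness

/-- [folklore] (arith) All constants `0` give `γγE_raw = 0`. -/
theorem devHessPoly_zero (C : ℝ) : devHessPoly C 0 0 0 0 0 0 0 0 0 0 = 0 := by
  simp [devHessPoly, gaugeHess, gaugeStep]

/-- Non-vacuity of `deviation_second_le`: for the flat pair `U₀ = U₁ ≡ 1` over `ℝ` every hypothesis holds with all
constants `0` (the comb gauge is trivial, `T4RelativeCombGradient.combGauge_self`) and the conclusion reads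
`‖Δ_μΔ_ρE‖ ≤ 0`. -/
example {d L : ℕ} (z y : Site d) (μ ρ α ν' : Fin d) (hne : α ≠ ν') (hy : InBlock L z y)
    (hy' : InBlock L z (y + e μ + e ρ + e α + e ν')) :
    ‖((plaq (gaugeAct (combGauge (fun _ _ => (1 : ℝˣ)) (fun _ _ => 1) z) (fun _ _ => 1)) (y + e μ + e ρ) α ν' : ℝ) -
          plaq (fun _ _ => (1 : ℝˣ)) (y + e μ + e ρ) α ν') -
        ((plaq (gaugeAct (combGauge (fun _ _ => (1 : ℝˣ)) (fun _ _ => 1) z) (fun _ _ => 1)) (y + e μ) α ν' : ℝ) -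
          plaq (fun _ _ => (1 : ℝˣ)) (y + e μ) α ν') -
        ((plaq (gaugeAct (combGauge (fun _ _ => (1 : ℝˣ)) (fun _ _ => 1) z) (fun _ _ => 1)) (y + e ρ) α ν' : ℝ) -
          plaq (fun _ _ => (1 : ℝˣ)) (y + e ρ) α ν') +
        ((plaq (gaugeAct (combGauge (fun _ _ => (1 : ℝˣ)) (fun _ _ => 1) z) (fun _ _ => 1)) y α ν' : ℝ) -
          plaq (fun _ _ => (1 : ℝˣ)) y α ν')‖ ≤ 0 := by
  have hg : combGauge (fun _ _ => (1 : ℝˣ)) (fun _ _ => (1 : ℝˣ)) z = fun _ => 1 :=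
    funext fun x => combGauge_self (d := d) (fun _ _ => (1 : ℝˣ)) z x
  have h1 : UnitaryLike (1 : ℝˣ) := UnitaryLike.one
  have H := deviation_second_le (R := ℝ) (U₀ := fun _ _ => (1 : ℝˣ)) (U₁ := fun _ _ => (1 : ℝˣ)) (z := z) (L := L)
    (s := 0) (q₁ := 0) (τ₀ := 0) (τ₁ := 0) (G := 0) (γU := 0) (γU₁ := 0) (γ₁ := 0) (γγP := 0) (γγ₁ := 0)
    (fun _ _ => h1) (fun _ _ => h1)
    (by intro y ρ ν' _ _ _ _ _; simp [hg, gaugeAct, plaq])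
    (by intro y ρ ν' _ _ _ _ _; simp [plaq])
    (by intro x ρ _ _; simp)
    (by intro x ρ _ _; simp)
    (by intro μ ν x _ _ _; simp [defect, hg, gaugeAct])
    (by intro μ x ρ _ _ _ _; simp)
    (by intro μ x ρ _ _ _ _; simp)
    (by intro μ y ρ ν' _ _ _ _ _ _ _ _ _; simp [plaq])
    (by intro μ ρ y α ν' _ _ _; simp [plaq])
    (by intro μ ρ y α ν' _ _ _; simp [plaq])
    le_rfl μ ρ y α ν' hne hy hy'
  rw [devHessPoly_zero] at H
  exact H

end Witness

/-! ## §6  (v1.1) The dictionary under printed-type inputs (arith; located audit `t4/T4-EST-OG1p-D3.md`)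

Of the letters of `D₃`, print supplies sup bounds at the stated rate for `s, q₀, q₁, τ₀, τ₁, γU, γU₁` and the count
`Cθ ≤ c`; for the second-order letters it supplies covariant LAPLACIAN bounds ((1.9), (1.39), (3.36), (3.38)) and
Hölder-`β` seminorms of first derivatives ((1.36), (3.31)/(3.32), (3.40), `β ≦ β₀ < 1`), NOT sups of mixed second
(let alone third) differences: "Such information is unavailable for the second order derivatives" (B8 p. 83), "Such
bounds do not hold for the operator D*D" (B12 p. 272).  One lattice step of a field with `‖A‖_{1,β} < c(L^jη)^{−2−β}`
moves plain differences of bond data by `η²·η^β·c(L^jη)^{−2−β} = cθ^{2+β}` (cell reading of the units, as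
`T4CombHolderWindow.printWin`): the PRINTED-TYPE rate of `γ₀, γ₁, γγU, γγP, γγ₁` is `θ^{2+β}`, not `θ³`/`θ⁴`.  The
theorems below record what the interpolation route of `T4CombHolderWindow` §6 / `T4CombSecondDifference` §6 then
yields — the exponent `2 + β²` instead of `2 + β`, NOT `θ`-uniformly comparable for `0 < β < 1` — and that the raw
plaquette letters enter `γγE_raw` with coefficient one.  Nothing here changes a v1 statement.  CORRECTION (v1.2): these
are statements about the INTERPOLATION ROUTE; whether the WINDOW closes under printed-type inputs depends on the comb
count and is settled in §7 — with a constant count (reading (A)) the TELESCOPED entry closes it with no extra letter,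
with `Cθ ≍ c` (reading (B)) the gradient slot fails first. -/

section PrintedInputs

/-- [folklore] (arith) `γγ₁ + γγP ≤ γγE_raw`: the two plaquette second-difference letters enter `devHessPoly` with
coefficient one (nonnegative data) — the discharged letter is never below its raw second-order inputs, so its rate
under any dictionary is at best theirs. -/
theorem le_devHessPoly {C s q₁ τ₀ τ₁ G γU γU₁ γ₁ γγP γγ₁ : ℝ} (hC : 0 ≤ C) (hs : 0 ≤ s) (hq1 : 0 ≤ q₁)
    (hτ0 : 0 ≤ τ₀) (hτ1 : 0 ≤ τ₁) (hG : 0 ≤ G) (hγU : 0 ≤ γU) (hγU1 : 0 ≤ γU₁) (hγ1 : 0 ≤ γ₁) :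
    γγ₁ + γγP ≤ devHessPoly C s q₁ τ₀ τ₁ G γU γU₁ γ₁ γγP γγ₁ := by
  have h1 := gaugeStep_nonneg hC hs hτ0 hτ1
  have h2 := gaugeHess_nonneg hC hs hτ0 hτ1 hG hγU hγU1
  unfold devHessPoly
  nlinarith [mul_nonneg h1 hγ1, mul_nonneg hq1 h2, mul_nonneg hq1 (sq_nonneg (gaugeStep C s τ₀ τ₁))]

/-- [folklore] (arith) THE INTERPOLATION EXPONENT UNDER PRINTED-TYPE SECOND-ORDER INPUTS: first differences at rate
`θ²` and second differences at the Hölder-derived rate `θ^{2+β}` interpolate to `θ^{2+β²}` — compare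
`T4CombHolderWindow.interp_exponent` (inputs at `θ³` give the slot's `θ^{2+β}`). -/
theorem interp_exponent_holderInputs {θ : ℝ} (hθ : 0 < θ) (β : ℝ) :
    (θ ^ 2) ^ (1 - β) * (θ ^ (2 + β)) ^ β = θ ^ (2 + β ^ 2) := by
  rw [show (θ ^ 2 : ℝ) = θ ^ (2 : ℝ) by norm_cast, ← Real.rpow_mul hθ.le, ← Real.rpow_mul hθ.le,
    ← Real.rpow_add hθ]
  congr 1; ring

/-- [folklore] (arith) THE INTERPOLATED HÖLDER ENTRY UNDER PRINTED-TYPE INPUTS: `b₁ ≤ a₁θ²` and `σ ≤ a₂θ^{2+β}`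
give `(2b₁)^{1−β}·σ^β ≤ (2a₁)^{1−β}·a₂^β·θ^{2+β²}` (`0 ≤ β ≤ 1`, nonnegative data) — the mirror of
`T4CombHolderWindow.interp_hol_entry` with the σ-slot at the printed-type rate. -/
theorem interp_hol_entry_holderInputs {θ β b₁ σ a₁ a₂ : ℝ} (hθ : 0 < θ) (hβ0 : 0 ≤ β) (hβ1 : β ≤ 1)
    (hb₁ : 0 ≤ b₁) (hσ : 0 ≤ σ) (h₁ : b₁ ≤ a₁ * θ ^ 2) (h₂ : σ ≤ a₂ * θ ^ (2 + β)) :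
    (2 * b₁) ^ (1 - β) * σ ^ β ≤ (2 * a₁) ^ (1 - β) * a₂ ^ β * θ ^ (2 + β ^ 2) := by
  have hθ2 : 0 < θ ^ 2 := pow_pos hθ 2
  have hθβ : 0 < θ ^ (2 + β) := Real.rpow_pos_of_pos hθ _
  have ha₁ : 0 ≤ a₁ := by nlinarith
  have ha₂ : 0 ≤ a₂ := by nlinarith
  calc (2 * b₁) ^ (1 - β) * σ ^ β ≤ (2 * (a₁ * θ ^ 2)) ^ (1 - β) * (a₂ * θ ^ (2 + β)) ^ β :=
        mul_le_mul (Real.rpow_le_rpow (by positivity) (by linarith) (by linarith))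
          (Real.rpow_le_rpow hσ h₂ hβ0) (Real.rpow_nonneg hσ _) (Real.rpow_nonneg (by positivity) _)
    _ = (2 * a₁) ^ (1 - β) * a₂ ^ β * ((θ ^ 2) ^ (1 - β) * (θ ^ (2 + β)) ^ β) := by
        rw [show 2 * (a₁ * θ ^ 2) = (2 * a₁) * θ ^ 2 by ring,
          Real.mul_rpow (by positivity) hθ2.le, Real.mul_rpow ha₂ hθβ.le]
        ring
    _ = (2 * a₁) ^ (1 - β) * a₂ ^ β * θ ^ (2 + β ^ 2) := by rw [interp_exponent_holderInputs hθ]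

/-- [folklore] (arith) THE SHORTFALL IS NOT `θ`-UNIFORM: for `0 < β < 1` there is NO `θ`-independent `a` with
`θ^{2+β²} ≤ a·θ^{2+β}` for all `0 < θ ≤ 1` (the ratio is `θ^{−β(1−β)} → ∞` as `θ = L^{−j} → 0`; witness
`θ = (2a)^{−1/(β−β²)}`).  Hence the interpolation route places the all-raw window inside a `θ`-independent multiple
of `printWin θ β` under `D₃` (`winN_printWin_second_allRaw_le`) but NOT under printed-type second-order inputs (v1.2:
the TELESCOPED route of §7 does, when the comb count is a constant — `winN_printWin_second_allRaw_tel_le`; the general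
form of this lemma is `rpow_not_dominated`). -/
theorem not_uniform_holderInputs {β : ℝ} (hβ0 : 0 < β) (hβ1 : β < 1) :
    ¬ ∃ a : ℝ, ∀ θ : ℝ, 0 < θ → θ ≤ 1 → θ ^ (2 + β ^ 2) ≤ a * θ ^ (2 + β) := by
  rintro ⟨a, ha⟩
  have ha1 : 1 ≤ a := by simpa using ha 1 one_pos le_rfl
  have ha0 : 0 < 2 * a := by linarith
  have he : 0 < β - β ^ 2 := by nlinarith
  obtain ⟨T, hT⟩ : ∃ T : ℝ, T = (2 * a) ^ (-(1 / (β - β ^ 2))) := ⟨_, rfl⟩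
  have hT0 : 0 < T := by rw [hT]; exact Real.rpow_pos_of_pos ha0 _
  have hT1 : T ≤ 1 := by
    rw [hT]
    exact Real.rpow_le_one_of_one_le_of_nonpos (by linarith) (neg_nonpos.mpr (div_nonneg zero_le_one he.le))
  have h1 : T ^ (β ^ 2 - β) = 2 * a := by
    rw [hT, ← Real.rpow_mul ha0.le]
    have : -(1 / (β - β ^ 2)) * (β ^ 2 - β) = (β - β ^ 2) / (β - β ^ 2) := by ring
    rw [this, div_self he.ne', Real.rpow_one]
  have hsplit : T ^ (2 + β ^ 2) = T ^ (2 + β) * (2 * a) := by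
    rw [← h1, ← Real.rpow_add hT0]
    congr 1; ring
  have key := ha T hT0 hT1
  rw [hsplit] at key
  have hp : 0 < T ^ (2 + β) := Real.rpow_pos_of_pos hT0 _
  nlinarith [mul_pos hp (show (0 : ℝ) < a by linarith)]

end PrintedInputs

/-! ## §7  (v1.2) THE TELESCOPED HÖLDER ENTRY; the window under the printed-type dictionary WITH A CONSTANT COMB
COUNT (reading (A)); the gradient-slot obstruction under `Cθ ≍ c` (reading (B)) — GAPS G-pv24g14-1 ADDENDUM

The comb count `C` enters the lineage's polynomials LINEARLY in front of the plaquette letters (`gradPoly ∋ C·(γ₀ +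
γ₁)`, `T4CombSecondDifference.secondW = secondFoot + C·secondSrc ∋ C·γγE`).  READING (A): the block side `L` of the
tree's comb is the FIXED integer of the construction — as at every level of the printed hierarchical axial gauge
[Balaban1985RegularSpaces] (1.15) p. 78 (one tree per block `B(·)` of side `L` on each scale; the tree's single comb
over `B(z)` has the shape of its lowest level «U(Γ_{x₁,x}) = 1 for x ∈ B(x₁)») — so `C = (d−1)(L−1) ≤ c` is a
constant and `θ = L^{−j}` an independent small parameter; then the printed-type dictionary (second-order letters at
the Hölder-derived rate `θ^{2+β}`, §6) puts `G_raw` at `θ²`, `σ` at `θ^{2+β}`, and the TELESCOPED window (third slot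
`L^{1−β}·σ`, no interpolation) inside a `θ`-independent multiple of `printWin θ β`.  READING (B): one comb over a block
of side `L^j`, `C = (d−1)(L^j−1)`, only `Cθ ≤ c` (the coupling written into `D₂`/`D₃`): printed-type plaquette
gradients make the gradient entry `≥ C·γ₀ ≍ θ^{1+β}`, not within a `θ`-independent multiple of `θ²`.  Both readings
are typed; which one a consumer adopts is a cell decision, not made here.  (arith) = real arithmetic on abstract
letters; NO claim about Bałaban's configurations. -/

open T4CombHolderWindow (fdiff add_nsmul_e_apply winN_printWin_le_iff)
open T4CombSecondDifference (secondDev_nonneg gradPoly_nonneg)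

section Telescoped

/-- [folklore] Two sites `x`, `x + m·e_ρ` of one block `B(z)` of side `L` are fewer than `L` lattice steps apart. -/
theorem lt_of_inBlock_nsmul {L : ℕ} {z x : Site d} {ρ : Fin d} {m : ℕ} (hx : InBlock L z x)
    (hxm : InBlock L z (x + m • e ρ)) : m < L := by
  have h1 := (hx ρ).1
  have h2 := (hxm ρ).2
  rw [add_nsmul_e_apply, if_pos rfl] at h2
  omega

/-- **THE TELESCOPED HÖLDER ENTRY** [folklore]: window data with a LIPSCHITZ-IN-STEPS third slot (exponent `1`,
entry `h`: `‖(∂_μD)(x + m·e_ρ; ν) − (∂_μD)(x; ν)‖ ≤ h·m`) is window data with any Hölder exponent `β ∈ [0, 1]` and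
the entry `L^{1−β}·h`: interior axis pairs of one block are `m < L` steps apart (`lt_of_inBlock_nsmul`) and
`h·m = h·m^{1−β}·m^β ≤ L^{1−β}·h·m^β`.  NO interpolation against the gradient slot; the price is the factor
`L^{1−β} ≤ L` (`rpow_one_sub_le_self`) — a CONSTANT when the block side `L` is the fixed integer of the
construction (reading (A) of the section docstring), of size `θ^{−(1−β)}` if the block side is `L^j = θ^{−1}`
(reading (B)). -/
theorem windowData_telescope {L : ℕ} {z : Site d} {β : ℝ} {D : Fld d R} {b₀ b₁ h : ℝ}
    (hW : WindowData L z 1 D ⟨b₀, b₁, h⟩) (hβ1 : β ≤ 1) :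
    WindowData L z β D ⟨b₀, b₁, (L : ℝ) ^ (1 - β) * h⟩ where
  sup_nonneg := hW.sup_nonneg
  grad_nonneg := hW.grad_nonneg
  hol_nonneg := mul_nonneg (Real.rpow_nonneg (Nat.cast_nonneg L) _) hW.hol_nonneg
  sup := hW.sup
  grad := hW.grad
  hol μ ν ρ x m hx hxμ hxμν hx' hx'μ hx'μν := by
    have hh : 0 ≤ h := hW.hol_nonneg
    have hL0 : (0 : ℝ) ≤ (L : ℝ) ^ (1 - β) := Real.rpow_nonneg (Nat.cast_nonneg L) _
    have H := hW.hol μ ν ρ x m hx hxμ hxμν hx' hx'μ hx'μν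
    simp only [Real.rpow_one] at H
    rcases Nat.eq_zero_or_pos m with rfl | hm
    · simp only [zero_smul, add_zero, sub_self, norm_zero, Nat.cast_zero]
      exact mul_nonneg (mul_nonneg hL0 hh) (Real.rpow_nonneg le_rfl _)
    · have hmL : (m : ℝ) ≤ (L : ℝ) := by exact_mod_cast (lt_of_inBlock_nsmul hx hx').le
      have hm0 : (0 : ℝ) < (m : ℝ) := by exact_mod_cast hm
      have hsplit : (m : ℝ) = (m : ℝ) ^ (1 - β) * (m : ℝ) ^ β := by
        rw [← Real.rpow_add hm0, sub_add_cancel, Real.rpow_one]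
      have hmono : (m : ℝ) ^ (1 - β) ≤ (L : ℝ) ^ (1 - β) := Real.rpow_le_rpow hm0.le hmL (by linarith)
      calc ‖fdiff D μ (x + m • e ρ) ν - fdiff D μ x ν‖ ≤ h * (m : ℝ) := H
        _ = h * (m : ℝ) ^ (1 - β) * (m : ℝ) ^ β := by rw [mul_assoc, ← hsplit]
        _ ≤ h * (L : ℝ) ^ (1 - β) * (m : ℝ) ^ β :=
            mul_le_mul_of_nonneg_right (mul_le_mul_of_nonneg_left hmono hh) (Real.rpow_nonneg hm0.le _)
        _ = (L : ℝ) ^ (1 - β) * h * (m : ℝ) ^ β := by ring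

/-- [folklore] (arith) `L^{1−β} ≤ L` for `L ≥ 1`, `0 ≤ β ≤ 1`: the telescoping factor is at most the block side. -/
theorem rpow_one_sub_le_self {x β : ℝ} (hx : 1 ≤ x) (hβ0 : 0 ≤ β) : x ^ (1 - β) ≤ x :=
  calc x ^ (1 - β) ≤ x ^ (1 : ℝ) := Real.rpow_le_rpow_of_exponent_le hx (by linarith)
    _ = x := Real.rpow_one x

variable [NormOneClass R] {L : ℕ} {z : Site d}

/-- **WINDOW DATA OF THE COMB DEFECT DEVIATION FROM RAW BLOCK SUPS WITH THE TELESCOPED HÖLDER ENTRY** (v1.2):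
the hypotheses of `windowData_comb_second_allRaw` VERBATIM ⟹ window data
`(C·s, G_raw + C·s·γU, L^{1−β}·σ)`, `σ` = the all-raw second-difference datum of §3 — obtained BY NAME from
`windowData_comb_second_allRaw` at exponent `1` (whose interpolated entry `(2b₁)^{1−1}σ^1` IS the one-step bound
`σ·m`) and `windowData_telescope`.  Compared with §3's interpolated entry `(2b₁)^{1−β}σ^β` the third slot is now
LINEAR in `σ`: under second-order inputs at the printed-type rate `θ^{2+β}` (§6) it sits at `θ^{2+β}` itself when
`L` is a constant (§7 rate theorems), where the interpolation gave only `θ^{2+β²}` (`interp_exponent_holderInputs`).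
[folklore] -/
theorem windowData_comb_second_allRaw_tel {U₀ U₁ : Cfg d R} {β s q₀ q₁ τ₀ τ₁ γU γU₁ γ₀ γ₁ γγU γγP γγ₁ : ℝ}
    (hβ1 : β ≤ 1) (hC : 0 ≤ ((d : ℝ) - 1) * ((L : ℝ) - 1))
    (hU₀ : ∀ x ν, UnitaryLike (U₀ x ν)) (hU₁ : ∀ x ν, UnitaryLike (U₁ x ν))
    (hs : PlaqSup L z (fun y ρ ν =>
      ‖(plaq (gaugeAct (combGauge U₀ U₁ z) U₁) y ρ ν : R) - plaq U₀ y ρ ν‖) s)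
    (hq₀ : PlaqSup L z (fun y ρ ν => ‖(plaq U₀ y ρ ν : R) - 1‖) q₀)
    (hq₁ : PlaqSup L z (fun y ρ ν => ‖(plaq U₁ y ρ ν : R) - 1‖) q₁)
    (hτ₀ : ∀ x ρ, InBlock L z x → InBlock L z (x + e ρ) → ‖(U₀ x ρ : R) - 1‖ ≤ τ₀)
    (hτ₁ : ∀ x ρ, InBlock L z x → InBlock L z (x + e ρ) → ‖(U₁ x ρ : R) - 1‖ ≤ τ₁)
    (hγU : ∀ μ x ρ, InBlock L z x → InBlock L z (x + e ρ) → InBlock L z (x + e μ) →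
      InBlock L z (x + e μ + e ρ) → ‖(U₀ (x + e μ) ρ : R) - U₀ x ρ‖ ≤ γU)
    (hγU₁ : ∀ μ x ρ, InBlock L z x → InBlock L z (x + e ρ) → InBlock L z (x + e μ) →
      InBlock L z (x + e μ + e ρ) → ‖(U₁ (x + e μ) ρ : R) - U₁ x ρ‖ ≤ γU₁)
    (hγ₀ : ∀ μ y ρ ν', ρ ≠ ν' → InBlock L z y → InBlock L z (y + e ρ) → InBlock L z (y + e ν') →
      InBlock L z (y + e ρ + e ν') → InBlock L z (y + e μ) → InBlock L z (y + e μ + e ρ) →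
      InBlock L z (y + e μ + e ν') → InBlock L z (y + e μ + e ρ + e ν') →
      ‖(plaq U₀ (y + e μ) ρ ν' : R) - plaq U₀ y ρ ν'‖ ≤ γ₀)
    (hγ₁ : ∀ μ y ρ ν', ρ ≠ ν' → InBlock L z y → InBlock L z (y + e ρ) → InBlock L z (y + e ν') →
      InBlock L z (y + e ρ + e ν') → InBlock L z (y + e μ) → InBlock L z (y + e μ + e ρ) →
      InBlock L z (y + e μ + e ν') → InBlock L z (y + e μ + e ρ + e ν') →
      ‖(plaq U₁ (y + e μ) ρ ν' : R) - plaq U₁ y ρ ν'‖ ≤ γ₁)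
    (hγγU : ∀ μ ρ x α, InBlock L z x → InBlock L z (x + e μ + e ρ + e α) →
      ‖(U₀ (x + e μ + e ρ) α : R) - U₀ (x + e μ) α - U₀ (x + e ρ) α + U₀ x α‖ ≤ γγU)
    (hγγP : ∀ μ ρ y α ν', α ≠ ν' → InBlock L z y → InBlock L z (y + e μ + e ρ + e α + e ν') →
      ‖(plaq U₀ (y + e μ + e ρ) α ν' : R) - plaq U₀ (y + e μ) α ν' - plaq U₀ (y + e ρ) α ν' +
          plaq U₀ y α ν'‖ ≤ γγP)
    (hγγ₁ : ∀ μ ρ y α ν', α ≠ ν' → InBlock L z y → InBlock L z (y + e μ + e ρ + e α + e ν') →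
      ‖(plaq U₁ (y + e μ + e ρ) α ν' : R) - plaq U₁ (y + e μ) α ν' - plaq U₁ (y + e ρ) α ν' +
          plaq U₁ y α ν'‖ ≤ γγ₁)
    (hs0 : 0 ≤ s) (hq0 : 0 ≤ q₀) (hq1 : 0 ≤ q₁) (hτ0 : 0 ≤ τ₀) (hτ1 : 0 ≤ τ₁) (hγU0 : 0 ≤ γU)
    (hγU10 : 0 ≤ γU₁) (hγ00 : 0 ≤ γ₀) (hγ10 : 0 ≤ γ₁) (hγγU0 : 0 ≤ γγU) (hγγP0 : 0 ≤ γγP) (hγγ10 : 0 ≤ γγ₁) :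
    WindowData L z β (blockDev L z (combGauge U₀ U₁ z) U₀ U₁)
      ⟨((d : ℝ) - 1) * ((L : ℝ) - 1) * s,
        gradRaw d L s q₀ q₁ τ₀ τ₁ γU γ₀ γ₁ + ((d : ℝ) - 1) * ((L : ℝ) - 1) * s * γU,
        (L : ℝ) ^ (1 - β) *
          secondDev (((d : ℝ) - 1) * ((L : ℝ) - 1)) s q₀ τ₀ (gradRaw d L s q₀ q₁ τ₀ τ₁ γU γ₀ γ₁) γU γ₀
            (devGradRaw d L s q₁ τ₀ τ₁ γ₀ γ₁) γγU γγP
            (devHessPoly (((d : ℝ) - 1) * ((L : ℝ) - 1)) s q₁ τ₀ τ₁ (gradRaw d L s q₀ q₁ τ₀ τ₁ γU γ₀ γ₁) γU γU₁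
              γ₁ γγP γγ₁)⟩ := by
  have hW := windowData_comb_second_allRaw (β := (1 : ℝ)) zero_le_one le_rfl hC hU₀ hU₁ hs hq₀ hq₁ hτ₀ hτ₁ hγU
    hγU₁ hγ₀ hγ₁ hγγU hγγP hγγ₁ hs0 hq0 hq1 hτ0 hτ1 hγU0 hγU10 hγ00 hγ10 hγγU0 hγγP0 hγγ10
  simp only [sub_self, Real.rpow_zero, Real.rpow_one, one_mul] at hW
  exact windowData_telescope hW hβ1

end Telescoped

/-! ### [arith] the rate under the printed-type dictionary with a CONSTANT comb count (reading (A)) -/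

section RateA

variable {θ c β C s q₀ q₁ τ τ₀ τ₁ G γU γU₁ γP γE γ₀ γ₁ γγU γγP γγE γγ₁ : ℝ}

/-- [folklore] (arith) `θ^k ≤ θ^{2+β}` for `k ≥ 3`, `0 < θ ≤ 1`, `β ≤ 1`. -/
theorem pow_le_rpow_printed (hθ : 0 < θ) (hθ1 : θ ≤ 1) (hβ1 : β ≤ 1) {k : ℕ} (hk : 3 ≤ k) :
    θ ^ k ≤ θ ^ (2 + β) := by
  have h3 : θ ^ 3 ≤ θ ^ (2 + β) := by
    rw [show (θ ^ 3 : ℝ) = θ ^ (3 : ℝ) by norm_cast]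
    exact Real.rpow_le_rpow_of_exponent_ge hθ hθ1 (by linarith)
  exact (pow_le_pow_of_le_one hθ.le hθ1 hk).trans h3

/-- [folklore] (arith) `θ^{2+β} ≤ θ²` for `0 < θ ≤ 1`, `0 ≤ β`. -/
theorem rpow_printed_le_sq (hθ : 0 < θ) (hθ1 : θ ≤ 1) (hβ0 : 0 ≤ β) : θ ^ (2 + β) ≤ θ ^ 2 := by
  rw [show (θ ^ 2 : ℝ) = θ ^ (2 : ℝ) by norm_cast]
  exact Real.rpow_le_rpow_of_exponent_ge hθ hθ1 (by linarith)

/-- [folklore] (arith) `θ^{2+β} ≤ 1` for `0 < θ ≤ 1`, `0 ≤ β`. -/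
theorem rpow_printed_le_one (hθ : 0 < θ) (hθ1 : θ ≤ 1) (hβ0 : 0 ≤ β) : θ ^ (2 + β) ≤ 1 :=
  Real.rpow_le_one hθ.le hθ1 (by linarith)

/-- [folklore] (arith) factor format: a letter `≤ cθ^{2+β}` is `≤ c¹θ⁰`. -/
theorem fac_rpow (hθ : 0 < θ) (hθ1 : θ ≤ 1) (hβ0 : 0 ≤ β) (hc0 : 0 ≤ c) {x : ℝ} (hx : x ≤ c * θ ^ (2 + β)) :
    x ≤ c ^ 1 * θ ^ 0 := by
  rw [pow_one, pow_zero, mul_one]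
  exact hx.trans ((mul_le_mul_of_nonneg_left (rpow_printed_le_one hθ hθ1 hβ0) hc0).trans_eq (mul_one c))

/-- [folklore] (arith) factor format: a letter `≤ cθ^{2+β}` is `≤ c¹θ²`. -/
theorem fac_rpow_sq (hθ : 0 < θ) (hθ1 : θ ≤ 1) (hβ0 : 0 ≤ β) (hc0 : 0 ≤ c) {x : ℝ}
    (hx : x ≤ c * θ ^ (2 + β)) : x ≤ c ^ 1 * θ ^ 2 := by
  rw [pow_one]
  exact hx.trans (mul_le_mul_of_nonneg_left (rpow_printed_le_sq hθ hθ1 hβ0) hc0)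

/-- [folklore] (arith) factor format: products. -/
theorem fac_mul (hθ0 : 0 ≤ θ) (hc0 : 0 ≤ c) {x y : ℝ} {a b i j : ℕ} (hx : x ≤ c ^ a * θ ^ i)
    (hy : y ≤ c ^ b * θ ^ j) (hy0 : 0 ≤ y) : x * y ≤ c ^ (a + b) * θ ^ (i + j) :=
  (mul_le_mul hx hy hy0 (by positivity)).trans_eq (by ring)

/-- [folklore] (arith) finisher, integer type: `x ≤ c^aθ^k`, `a ≤ 5`, `k ≥ 3` ⟹ `x ≤ c⁵θ^{2+β}`. -/
theorem fin_int (hθ : 0 < θ) (hθ1 : θ ≤ 1) (hβ1 : β ≤ 1) (hc1 : 1 ≤ c) {x : ℝ} {a k : ℕ}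
    (hx : x ≤ c ^ a * θ ^ k) (ha : a ≤ 5) (hk : 3 ≤ k) : x ≤ c ^ 5 * θ ^ (2 + β) := by
  have hc0 : 0 ≤ c := by linarith
  exact hx.trans (mul_le_mul (pow_le_pow_right₀ hc1 ha) (pow_le_rpow_printed hθ hθ1 hβ1 hk) (by positivity)
    (by positivity))

/-- [folklore] (arith) finisher, one Hölder-type letter: `x ≤ c^aθ^k`, `0 ≤ ℓ ≤ cθ^{2+β}`, `a + 1 ≤ 5` ⟹
`x·ℓ ≤ c⁵θ^{2+β}`. -/
theorem fin_rpow (hθ : 0 < θ) (hθ1 : θ ≤ 1) (hc1 : 1 ≤ c) {x ℓ : ℝ} {a k : ℕ} (hx : x ≤ c ^ a * θ ^ k)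
    (hℓ : ℓ ≤ c * θ ^ (2 + β)) (hℓ0 : 0 ≤ ℓ) (ha : a + 1 ≤ 5) : x * ℓ ≤ c ^ 5 * θ ^ (2 + β) := by
  have hc0 : 0 ≤ c := by linarith
  have hθk : θ ^ k ≤ 1 := pow_le_one₀ hθ.le hθ1
  have hr0 : 0 ≤ θ ^ (2 + β) := Real.rpow_nonneg hθ.le _
  calc x * ℓ ≤ (c ^ a * θ ^ k) * (c * θ ^ (2 + β)) := mul_le_mul hx hℓ hℓ0 (by positivity)
    _ = c ^ (a + 1) * (θ ^ k * θ ^ (2 + β)) := by ring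
    _ ≤ c ^ 5 * (1 * θ ^ (2 + β)) :=
        mul_le_mul (pow_le_pow_right₀ hc1 ha) (mul_le_mul_of_nonneg_right hθk hr0) (by positivity)
          (by positivity)
    _ = c ^ 5 * θ ^ (2 + β) := by rw [one_mul]

/-- [folklore] (arith) finisher, a bare Hölder-type letter: `ℓ ≤ cθ^{2+β} ≤ c⁵θ^{2+β}`. -/
theorem fin_one (hθ : 0 < θ) (hc1 : 1 ≤ c) {ℓ : ℝ} (hℓ : ℓ ≤ c * θ ^ (2 + β)) : ℓ ≤ c ^ 5 * θ ^ (2 + β) :=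
  hℓ.trans (mul_le_mul_of_nonneg_right (le_self_pow₀ hc1 (by norm_num)) (Real.rpow_nonneg hθ.le _))

/-- [folklore] (arith) finisher for the gradient polynomial: `x ≤ c^aθ^k`, `a ≤ 4`, `k ≥ 2` ⟹ `x ≤ c⁴θ²`. -/
theorem fin_sq (hθ : 0 < θ) (hθ1 : θ ≤ 1) (hc1 : 1 ≤ c) {x : ℝ} {a k : ℕ} (hx : x ≤ c ^ a * θ ^ k)
    (ha : a ≤ 4) (hk : 2 ≤ k) : x ≤ c ^ 4 * θ ^ 2 := by
  have hc0 : 0 ≤ c := by linarith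
  exact hx.trans (mul_le_mul (pow_le_pow_right₀ hc1 ha) (pow_le_pow_of_le_one hθ.le hθ1 hk) (by positivity)
    (by positivity))

/-- **`G_raw = O(θ²)` UNDER THE PRINTED-TYPE DICTIONARY WITH A CONSTANT COMB COUNT** (arith, reading (A)):
`C ≤ c`, `s, q₀, q₁, γU ≤ cθ²`, `τ₀, τ₁ ≤ cθ`, and the plaquette gradients at the Hölder-derived rate
`γ₀, γ₁ ≤ cθ^{2+β}` (`0 ≤ β`) give `gradPoly C s q₀ q₁ τ₀ τ₁ γU γ₀ γ₁ ≤ 21c⁴θ²` (13 monomials) — the gradient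
weight `θ²` of `printWin`, with NO letter beyond printed type.  Contrast reading (B) (`le_gradPoly_C`,
`readingB_gradTerm`, `gradSlot_not_uniform_readingB`).  [folklore] -/
theorem gradPoly_le_rateA (hθ : 0 < θ) (hθ1 : θ ≤ 1) (hβ0 : 0 ≤ β) (hc1 : 1 ≤ c) (hC0 : 0 ≤ C) (hs0 : 0 ≤ s)
    (hq0 : 0 ≤ q₀) (hq1 : 0 ≤ q₁) (hτ0 : 0 ≤ τ₀) (hτ1 : 0 ≤ τ₁) (hγU0 : 0 ≤ γU) (hγ00 : 0 ≤ γ₀)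
    (hγ10 : 0 ≤ γ₁) (hC : C ≤ c) (hs : s ≤ c * θ ^ 2) (hq₀ : q₀ ≤ c * θ ^ 2) (hq₁ : q₁ ≤ c * θ ^ 2)
    (hτ₀ : τ₀ ≤ c * θ) (hτ₁ : τ₁ ≤ c * θ) (hγU : γU ≤ c * θ ^ 2) (hγ₀ : γ₀ ≤ c * θ ^ (2 + β))
    (hγ₁ : γ₁ ≤ c * θ ^ (2 + β)) : gradPoly C s q₀ q₁ τ₀ τ₁ γU γ₀ γ₁ ≤ 21 * c ^ 4 * θ ^ 2 := by
  have hc0 : 0 ≤ c := by linarith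
  have hθ0 := hθ.le
  have fC : C ≤ c ^ 1 * θ ^ 0 := by rw [pow_one, pow_zero, mul_one]; exact hC
  have fs : s ≤ c ^ 1 * θ ^ 2 := by rwa [pow_one]
  have fq0 : q₀ ≤ c ^ 1 * θ ^ 2 := by rwa [pow_one]
  have fq1 : q₁ ≤ c ^ 1 * θ ^ 2 := by rwa [pow_one]
  have ft0 : τ₀ ≤ c ^ 1 * θ ^ 1 := by rwa [pow_one, pow_one]
  have ft1 : τ₁ ≤ c ^ 1 * θ ^ 1 := by rwa [pow_one, pow_one]
  have fγU : γU ≤ c ^ 1 * θ ^ 2 := by rwa [pow_one]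
  have fγ0 : γ₀ ≤ c ^ 1 * θ ^ 2 := fac_rpow_sq hθ hθ1 hβ0 hc0 hγ₀
  have fγ1 : γ₁ ≤ c ^ 1 * θ ^ 2 := fac_rpow_sq hθ hθ1 hβ0 hc0 hγ₁
  have hCs := fac_mul hθ0 hc0 fC fs hs0
  have hCC := fac_mul hθ0 hc0 fC fC hC0
  have m1 : C * γ₀ ≤ c ^ 4 * θ ^ 2 := fin_sq hθ hθ1 hc1 (fac_mul hθ0 hc0 fC fγ0 hγ00) (by norm_num) (by norm_num)
  have m2 : C * γ₀ * s ≤ c ^ 4 * θ ^ 2 :=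
    fin_sq hθ hθ1 hc1 (fac_mul hθ0 hc0 (fac_mul hθ0 hc0 fC fγ0 hγ00) fs hs0) (by norm_num) (by norm_num)
  have m3 : C * γ₁ ≤ c ^ 4 * θ ^ 2 := fin_sq hθ hθ1 hc1 (fac_mul hθ0 hc0 fC fγ1 hγ10) (by norm_num) (by norm_num)
  have m4 : C * γU * s ≤ c ^ 4 * θ ^ 2 :=
    fin_sq hθ hθ1 hc1 (fac_mul hθ0 hc0 (fac_mul hθ0 hc0 fC fγU hγU0) fs hs0) (by norm_num) (by norm_num)
  have m5 : C * q₀ * s ≤ c ^ 4 * θ ^ 2 :=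
    fin_sq hθ hθ1 hc1 (fac_mul hθ0 hc0 (fac_mul hθ0 hc0 fC fq0 hq0) fs hs0) (by norm_num) (by norm_num)
  have m6 : C * q₁ * τ₀ ≤ c ^ 4 * θ ^ 2 :=
    fin_sq hθ hθ1 hc1 (fac_mul hθ0 hc0 (fac_mul hθ0 hc0 fC fq1 hq1) ft0 hτ0) (by norm_num) (by norm_num)
  have m7 : C * q₁ * τ₁ ≤ c ^ 4 * θ ^ 2 :=
    fin_sq hθ hθ1 hc1 (fac_mul hθ0 hc0 (fac_mul hθ0 hc0 fC fq1 hq1) ft1 hτ1) (by norm_num) (by norm_num)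
  have m8 : C * s * τ₀ ≤ c ^ 4 * θ ^ 2 :=
    fin_sq hθ hθ1 hc1 (fac_mul hθ0 hc0 hCs ft0 hτ0) (by norm_num) (by norm_num)
  have m9 : C * s * s ≤ c ^ 4 * θ ^ 2 :=
    fin_sq hθ hθ1 hc1 (fac_mul hθ0 hc0 hCs fs hs0) (by norm_num) (by norm_num)
  have m10 : C * C * γ₀ * s ≤ c ^ 4 * θ ^ 2 :=
    fin_sq hθ hθ1 hc1 (fac_mul hθ0 hc0 (fac_mul hθ0 hc0 hCC fγ0 hγ00) fs hs0) (by norm_num) (by norm_num)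
  have m11 : C * C * γU * s ≤ c ^ 4 * θ ^ 2 :=
    fin_sq hθ hθ1 hc1 (fac_mul hθ0 hc0 (fac_mul hθ0 hc0 hCC fγU hγU0) fs hs0) (by norm_num) (by norm_num)
  have m12 : C * C * q₁ * s ≤ c ^ 4 * θ ^ 2 :=
    fin_sq hθ hθ1 hc1 (fac_mul hθ0 hc0 (fac_mul hθ0 hc0 hCC fq1 hq1) fs hs0) (by norm_num) (by norm_num)
  have m13 : s ≤ c ^ 4 * θ ^ 2 := fin_sq hθ hθ1 hc1 fs (by norm_num) (by norm_num)
  unfold gradPoly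
  linarith

/-- **`γE_raw = O(θ^{2+β})` UNDER READING (A)** (arith): `devGradPoly C s q₁ τ₀ τ₁ γ₀ γ₁ ≤ 8c⁵θ^{2+β}`.  [folklore] -/
theorem devGradPoly_le_rateA (hθ : 0 < θ) (hθ1 : θ ≤ 1) (hβ1 : β ≤ 1) (hc1 : 1 ≤ c) (hC0 : 0 ≤ C)
    (hs0 : 0 ≤ s) (hτ0 : 0 ≤ τ₀) (hτ1 : 0 ≤ τ₁) (hC : C ≤ c) (hs : s ≤ c * θ ^ 2)
    (hq₁ : q₁ ≤ c * θ ^ 2) (hτ₀ : τ₀ ≤ c * θ) (hτ₁ : τ₁ ≤ c * θ) (hγ₀ : γ₀ ≤ c * θ ^ (2 + β))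
    (hγ₁ : γ₁ ≤ c * θ ^ (2 + β)) : devGradPoly C s q₁ τ₀ τ₁ γ₀ γ₁ ≤ 8 * c ^ 5 * θ ^ (2 + β) := by
  have hc0 : 0 ≤ c := by linarith
  have hθ0 := hθ.le
  have fC : C ≤ c ^ 1 * θ ^ 0 := by rw [pow_one, pow_zero, mul_one]; exact hC
  have fs : s ≤ c ^ 1 * θ ^ 2 := by rwa [pow_one]
  have fq1 : q₁ ≤ c ^ 1 * θ ^ 2 := by rwa [pow_one]
  have ft0 : τ₀ ≤ c ^ 1 * θ ^ 1 := by rwa [pow_one, pow_one]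
  have ft1 : τ₁ ≤ c ^ 1 * θ ^ 1 := by rwa [pow_one, pow_one]
  have m1 : γ₁ ≤ c ^ 5 * θ ^ (2 + β) := fin_one hθ hc1 hγ₁
  have m2 : γ₀ ≤ c ^ 5 * θ ^ (2 + β) := fin_one hθ hc1 hγ₀
  have m3 : q₁ * τ₀ ≤ c ^ 5 * θ ^ (2 + β) :=
    fin_int hθ hθ1 hβ1 hc1 (fac_mul hθ0 hc0 fq1 ft0 hτ0) (by norm_num) (by norm_num)
  have m4 : q₁ * τ₁ ≤ c ^ 5 * θ ^ (2 + β) :=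
    fin_int hθ hθ1 hβ1 hc1 (fac_mul hθ0 hc0 fq1 ft1 hτ1) (by norm_num) (by norm_num)
  have m5 : q₁ * C * s ≤ c ^ 5 * θ ^ (2 + β) :=
    fin_int hθ hθ1 hβ1 hc1 (fac_mul hθ0 hc0 (fac_mul hθ0 hc0 fq1 fC hC0) fs hs0) (by norm_num) (by norm_num)
  unfold devGradPoly
  linarith

/-- **`γγE_raw = O(θ^{2+β})` UNDER READING (A)** (arith): with `G ≤ 21c⁴θ²` (`gradPoly_le_rateA`), `C ≤ c`, the
first-order letters as in `D₃` and `γ₁, γγP, γγ₁ ≤ cθ^{2+β}`: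
`devHessPoly C s q₁ τ₀ τ₁ G γU γU₁ γ₁ γγP γγ₁ ≤ 118c⁵θ^{2+β}` (`1 + 12 + 68 + 36 + 1`; `δ_g ≤ 3c²θ` and
`δδ_g ≤ 34c⁴θ²` from §4 since `Cθ ≤ C ≤ c`).  [folklore] -/
theorem devHessPoly_le_rateA (hθ : 0 < θ) (hθ1 : θ ≤ 1) (hβ1 : β ≤ 1) (hc1 : 1 ≤ c) (hC0 : 0 ≤ C)
    (hs0 : 0 ≤ s) (hτ0 : 0 ≤ τ₀) (hτ1 : 0 ≤ τ₁) (hG0 : 0 ≤ G) (hγU0 : 0 ≤ γU) (hγU10 : 0 ≤ γU₁)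
    (hγ10 : 0 ≤ γ₁) (hC : C ≤ c) (hs : s ≤ c * θ ^ 2) (hq₁ : q₁ ≤ c * θ ^ 2) (hτ₀ : τ₀ ≤ c * θ)
    (hτ₁ : τ₁ ≤ c * θ) (hG : G ≤ 21 * c ^ 4 * θ ^ 2) (hγU : γU ≤ c * θ ^ 2) (hγU₁ : γU₁ ≤ c * θ ^ 2)
    (hγ₁ : γ₁ ≤ c * θ ^ (2 + β)) (hγγP : γγP ≤ c * θ ^ (2 + β)) (hγγ₁ : γγ₁ ≤ c * θ ^ (2 + β)) :
    devHessPoly C s q₁ τ₀ τ₁ G γU γU₁ γ₁ γγP γγ₁ ≤ 118 * c ^ 5 * θ ^ (2 + β) := by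
  have hc0 : 0 ≤ c := by linarith
  have hθ0 := hθ.le
  have hCθ : C * θ ≤ c := (mul_le_of_le_one_right hC0 hθ1).trans hC
  have hδ := gaugeStep_le_rate hθ0 hc1 hC0 hCθ hs hτ₀ hτ₁
  have hδ0 := gaugeStep_nonneg hC0 hs0 hτ0 hτ1
  have hδδ := gaugeHess_le_rate hθ0 hθ1 hc1 hC0 hs0 hτ0 hτ1 hγU10 hCθ hs hτ₀ hτ₁ hG hγU hγU₁
  have hδδ0 := gaugeHess_nonneg hC0 hs0 hτ0 hτ1 hG0 hγU0 hγU10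
  have hr0 : 0 ≤ θ ^ (2 + β) := Real.rpow_nonneg hθ0 _
  have h4 : θ ^ 4 ≤ θ ^ (2 + β) := pow_le_rpow_printed hθ hθ1 hβ1 (by norm_num)
  have hθr : θ * θ ^ (2 + β) ≤ θ ^ (2 + β) := (mul_le_mul_of_nonneg_right hθ1 hr0).trans_eq (one_mul _)
  have hc5 : c ≤ c ^ 5 := le_self_pow₀ hc1 (by norm_num)
  have hc35 : c ^ 3 ≤ c ^ 5 := pow_le_pow_right₀ hc1 (by norm_num)
  have m1 : γγ₁ ≤ c ^ 5 * θ ^ (2 + β) := hγγ₁.trans (mul_le_mul_of_nonneg_right hc5 hr0)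
  have m5 : γγP ≤ c ^ 5 * θ ^ (2 + β) := hγγP.trans (mul_le_mul_of_nonneg_right hc5 hr0)
  have m2 : 4 * gaugeStep C s τ₀ τ₁ * γ₁ ≤ 12 * c ^ 5 * θ ^ (2 + β) := by
    have h : gaugeStep C s τ₀ τ₁ * γ₁ ≤ (3 * c ^ 2 * θ) * (c * θ ^ (2 + β)) :=
      mul_le_mul hδ hγ₁ hγ10 (by positivity)
    have h' : (3 * c ^ 2 * θ) * (c * θ ^ (2 + β)) = 3 * c ^ 3 * (θ * θ ^ (2 + β)) := by ring
    have h'' : 3 * c ^ 3 * (θ * θ ^ (2 + β)) ≤ 3 * c ^ 5 * θ ^ (2 + β) :=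
      mul_le_mul (by linarith) hθr (by positivity) (by positivity)
    linarith
  have m3 : 2 * q₁ * gaugeHess C s τ₀ τ₁ G γU γU₁ ≤ 68 * c ^ 5 * θ ^ (2 + β) := by
    have h : q₁ * gaugeHess C s τ₀ τ₁ G γU γU₁ ≤ (c * θ ^ 2) * (34 * c ^ 4 * θ ^ 2) :=
      mul_le_mul hq₁ hδδ hδδ0 (by positivity)
    have h' : (c * θ ^ 2) * (34 * c ^ 4 * θ ^ 2) = 34 * c ^ 5 * θ ^ 4 := by ring
    have h'' : 34 * c ^ 5 * θ ^ 4 ≤ 34 * c ^ 5 * θ ^ (2 + β) := mul_le_mul_of_nonneg_left h4 (by positivity)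
    linarith
  have m4 : 4 * q₁ * gaugeStep C s τ₀ τ₁ ^ 2 ≤ 36 * c ^ 5 * θ ^ (2 + β) := by
    have hsq : gaugeStep C s τ₀ τ₁ ^ 2 ≤ (3 * c ^ 2 * θ) ^ 2 := pow_le_pow_left₀ hδ0 hδ 2
    have h : q₁ * gaugeStep C s τ₀ τ₁ ^ 2 ≤ (c * θ ^ 2) * (3 * c ^ 2 * θ) ^ 2 :=
      mul_le_mul hq₁ hsq (by positivity) (by positivity)
    have h' : (c * θ ^ 2) * (3 * c ^ 2 * θ) ^ 2 = 9 * c ^ 5 * θ ^ 4 := by ring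
    have h'' : 9 * c ^ 5 * θ ^ 4 ≤ 9 * c ^ 5 * θ ^ (2 + β) := mul_le_mul_of_nonneg_left h4 (by positivity)
    linarith
  unfold devHessPoly; linarith

/-- **THE SECOND-DIFFERENCE DATUM IS `O(θ^{2+β})` UNDER THE PRINTED-TYPE DICTIONARY WITH A CONSTANT COMB COUNT**
(arith, reading (A); abstract letters): `0 < θ ≤ 1 ≤ c`, `0 ≤ β ≤ 1`, `C ≤ c`, `s, q₀, G, γU ≤ cθ²`, `τ ≤ cθ`, and
EVERY deviation / second-order letter at the Hölder-derived rate `γP, γE, γγU, γγP, γγE ≤ cθ^{2+β}` ⟹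
`secondDev C s q₀ τ G γU γP γE γγU γγP γγE ≤ 73c⁵θ^{2+β}` (28 monomials: each carries a letter of rate `θ^{2+β}`
times factors `≤ c^a`, or is a product of integer-rate letters of total order `≥ 3`, and `θ³ ≤ θ^{2+β}`).  With a
constant `C` NO letter beyond printed type is needed for the `σ`-slot; contrast `T4CombSecondDifference.secondDev_
le_rate` (dictionary `D₂`: `Cθ ≤ c`, `γγE ≤ cθ⁴`).  [folklore] -/
theorem secondDev_le_rateA (hθ : 0 < θ) (hθ1 : θ ≤ 1) (hβ0 : 0 ≤ β) (hβ1 : β ≤ 1) (hc1 : 1 ≤ c)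
    (hC0 : 0 ≤ C) (hs0 : 0 ≤ s) (hq0 : 0 ≤ q₀) (hτ0 : 0 ≤ τ) (hG0 : 0 ≤ G) (hγU0 : 0 ≤ γU) (hγP0 : 0 ≤ γP)
    (hγE0 : 0 ≤ γE) (hγγU0 : 0 ≤ γγU) (hγγP0 : 0 ≤ γγP) (hγγE0 : 0 ≤ γγE) (hC : C ≤ c) (hs : s ≤ c * θ ^ 2)
    (hq : q₀ ≤ c * θ ^ 2) (hτ : τ ≤ c * θ) (hG2 : G ≤ c * θ ^ 2) (hγU2 : γU ≤ c * θ ^ 2)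
    (hγP : γP ≤ c * θ ^ (2 + β)) (hγE : γE ≤ c * θ ^ (2 + β)) (hγγU : γγU ≤ c * θ ^ (2 + β))
    (hγγP : γγP ≤ c * θ ^ (2 + β)) (hγγE : γγE ≤ c * θ ^ (2 + β)) :
    secondDev C s q₀ τ G γU γP γE γγU γγP γγE ≤ 73 * c ^ 5 * θ ^ (2 + β) := by
  have hc0 : 0 ≤ c := by linarith
  have hθ0 := hθ.le
  have fC : C ≤ c ^ 1 * θ ^ 0 := by rw [pow_one, pow_zero, mul_one]; exact hC
  have fs : s ≤ c ^ 1 * θ ^ 2 := by rwa [pow_one]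
  have fq : q₀ ≤ c ^ 1 * θ ^ 2 := by rwa [pow_one]
  have fτ : τ ≤ c ^ 1 * θ ^ 1 := by rwa [pow_one, pow_one]
  have fG : G ≤ c ^ 1 * θ ^ 2 := by rwa [pow_one]
  have fγU : γU ≤ c ^ 1 * θ ^ 2 := by rwa [pow_one]
  have fγP : γP ≤ c ^ 1 * θ ^ 0 := fac_rpow hθ hθ1 hβ0 hc0 hγP
  have hCG := fac_mul hθ0 hc0 fC fG hG0
  have hCC := fac_mul hθ0 hc0 fC fC hC0
  have hCs := fac_mul hθ0 hc0 fC fs hs0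
  have hCγU := fac_mul hθ0 hc0 fC fγU hγU0
  have hCγP := fac_mul hθ0 hc0 fC fγP hγP0
  have hCCs := fac_mul hθ0 hc0 hCC fs hs0
  have m1 : C * G * γE ≤ c ^ 5 * θ ^ (2 + β) := fin_rpow hθ hθ1 hc1 hCG hγE hγE0 (by norm_num)
  have m2 : C * G * γP ≤ c ^ 5 * θ ^ (2 + β) := fin_rpow hθ hθ1 hc1 hCG hγP hγP0 (by norm_num)
  have m3 : C * G * γU ≤ c ^ 5 * θ ^ (2 + β) :=
    fin_int hθ hθ1 hβ1 hc1 (fac_mul hθ0 hc0 hCG fγU hγU0) (by norm_num) (by norm_num)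
  have m4 : C * γP * γE ≤ c ^ 5 * θ ^ (2 + β) := fin_rpow hθ hθ1 hc1 hCγP hγE hγE0 (by norm_num)
  have m5 : C * γU * γE ≤ c ^ 5 * θ ^ (2 + β) := fin_rpow hθ hθ1 hc1 hCγU hγE hγE0 (by norm_num)
  have m6 : C * γU * s * γP ≤ c ^ 5 * θ ^ (2 + β) :=
    fin_rpow hθ hθ1 hc1 (fac_mul hθ0 hc0 hCγU fs hs0) hγP hγP0 (by norm_num)
  have m7 : C * s * γP ≤ c ^ 5 * θ ^ (2 + β) := fin_rpow hθ hθ1 hc1 hCs hγP hγP0 (by norm_num)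
  have m8 : C * γP * s * γP ≤ c ^ 5 * θ ^ (2 + β) :=
    fin_rpow hθ hθ1 hc1 (fac_mul hθ0 hc0 hCγP fs hs0) hγP hγP0 (by norm_num)
  have m9 : C * γU * s ≤ c ^ 5 * θ ^ (2 + β) :=
    fin_int hθ hθ1 hβ1 hc1 (fac_mul hθ0 hc0 hCγU fs hs0) (by norm_num) (by norm_num)
  have m10 : C * γU * γU * s ≤ c ^ 5 * θ ^ (2 + β) :=
    fin_int hθ hθ1 hβ1 hc1 (fac_mul hθ0 hc0 (fac_mul hθ0 hc0 hCγU fγU hγU0) fs hs0) (by norm_num) (by norm_num)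
  have m11 : C * γγE ≤ c ^ 5 * θ ^ (2 + β) := fin_rpow hθ hθ1 hc1 fC hγγE hγγE0 (by norm_num)
  have m12 : C * s * γγP ≤ c ^ 5 * θ ^ (2 + β) := fin_rpow hθ hθ1 hc1 hCs hγγP hγγP0 (by norm_num)
  have m13 : C * s * γγU ≤ c ^ 5 * θ ^ (2 + β) := fin_rpow hθ hθ1 hc1 hCs hγγU hγγU0 (by norm_num)
  have m14 : C * C * γP * s * γE ≤ c ^ 5 * θ ^ (2 + β) :=
    fin_rpow hθ hθ1 hc1 (fac_mul hθ0 hc0 (fac_mul hθ0 hc0 hCC fγP hγP0) fs hs0) hγE hγE0 (by norm_num)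
  have m15 : C * C * γU * s * γE ≤ c ^ 5 * θ ^ (2 + β) :=
    fin_rpow hθ hθ1 hc1 (fac_mul hθ0 hc0 (fac_mul hθ0 hc0 hCC fγU hγU0) fs hs0) hγE hγE0 (by norm_num)
  have m16 : C * C * γU * s * γP ≤ c ^ 5 * θ ^ (2 + β) :=
    fin_rpow hθ hθ1 hc1 (fac_mul hθ0 hc0 (fac_mul hθ0 hc0 hCC fγU hγU0) fs hs0) hγP hγP0 (by norm_num)
  have m17 : C * C * γP * s * γP ≤ c ^ 5 * θ ^ (2 + β) :=
    fin_rpow hθ hθ1 hc1 (fac_mul hθ0 hc0 (fac_mul hθ0 hc0 hCC fγP hγP0) fs hs0) hγP hγP0 (by norm_num)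
  have m18 : C * C * γU * γU * s ≤ c ^ 5 * θ ^ (2 + β) :=
    fin_int hθ hθ1 hβ1 hc1 (fac_mul hθ0 hc0 (fac_mul hθ0 hc0 (fac_mul hθ0 hc0 hCC fγU hγU0) fγU hγU0) fs hs0)
      (by norm_num) (by norm_num)
  have m19 : C * C * s * γγE ≤ c ^ 5 * θ ^ (2 + β) := fin_rpow hθ hθ1 hc1 hCCs hγγE hγγE0 (by norm_num)
  have m20 : C * C * s * γγP ≤ c ^ 5 * θ ^ (2 + β) := fin_rpow hθ hθ1 hc1 hCCs hγγP hγγP0 (by norm_num)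
  have m21 : C * C * s * γγU ≤ c ^ 5 * θ ^ (2 + β) := fin_rpow hθ hθ1 hc1 hCCs hγγU hγγU0 (by norm_num)
  have m22 : G * γU ≤ c ^ 5 * θ ^ (2 + β) :=
    fin_int hθ hθ1 hβ1 hc1 (fac_mul hθ0 hc0 fG fγU hγU0) (by norm_num) (by norm_num)
  have m23 : G * q₀ ≤ c ^ 5 * θ ^ (2 + β) :=
    fin_int hθ hθ1 hβ1 hc1 (fac_mul hθ0 hc0 fG fq hq0) (by norm_num) (by norm_num)
  have m24 : G * s ≤ c ^ 5 * θ ^ (2 + β) :=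
    fin_int hθ hθ1 hβ1 hc1 (fac_mul hθ0 hc0 fG fs hs0) (by norm_num) (by norm_num)
  have m25 : G * τ ≤ c ^ 5 * θ ^ (2 + β) :=
    fin_int hθ hθ1 hβ1 hc1 (fac_mul hθ0 hc0 fG fτ hτ0) (by norm_num) (by norm_num)
  have m26 : γE ≤ c ^ 5 * θ ^ (2 + β) := fin_one hθ hc1 hγE
  have m27 : s * γP ≤ c ^ 5 * θ ^ (2 + β) := fin_rpow hθ hθ1 hc1 fs hγP hγP0 (by norm_num)
  have m28 : γU * s ≤ c ^ 5 * θ ^ (2 + β) :=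
    fin_int hθ hθ1 hβ1 hc1 (fac_mul hθ0 hc0 fγU fs hs0) (by norm_num) (by norm_num)
  simp only [secondDev, T4CombSecondDifference.secondW, T4CombSecondDifference.secondFoot,
    T4CombSecondDifference.secondSrc, T4CombSecondDifference.mapGrad, T4CombSecondDifference.mapHess,
    T4CombSecondDifference.devHess]
  linarith

/-- **THE ALL-RAW SECOND-DIFFERENCE DATUM IS `O(θ^{2+β})` UNDER THE PRINTED-TYPE DICTIONARY WITH A CONSTANT COMB
COUNT** (arith, reading (A); the COMPOSITION typed as one theorem): `0 < θ ≤ 1 ≤ c`, `0 ≤ β ≤ 1`, `C ≤ c`,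
`s, q₀, q₁, γU, γU₁ ≤ cθ²`, `τ₀, τ₁ ≤ cθ`, `γ₀, γ₁, γγU, γγP, γγ₁ ≤ cθ^{2+β}` ⟹ the `σ` of §3 is
`≤ 73·(118c⁵)⁵·θ^{2+β}` (`G_raw ≤ 21c⁴θ²`, `γE_raw ≤ 8c⁵θ^{2+β}`, `γγE_raw ≤ 118c⁵θ^{2+β}`, every letter lifted to
`c″ = 118c⁵` in `secondDev_le_rateA`).  Constants not optimised.  [folklore] -/
theorem secondDev_allRaw_le_rateA (hθ : 0 < θ) (hθ1 : θ ≤ 1) (hβ0 : 0 ≤ β) (hβ1 : β ≤ 1) (hc1 : 1 ≤ c)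
    (hC0 : 0 ≤ C) (hs0 : 0 ≤ s) (hq0 : 0 ≤ q₀) (hq1 : 0 ≤ q₁) (hτ0 : 0 ≤ τ₀) (hτ1 : 0 ≤ τ₁) (hγU0 : 0 ≤ γU)
    (hγU10 : 0 ≤ γU₁) (hγ00 : 0 ≤ γ₀) (hγ10 : 0 ≤ γ₁) (hγγU0 : 0 ≤ γγU) (hγγP0 : 0 ≤ γγP) (hγγ10 : 0 ≤ γγ₁)
    (hC : C ≤ c) (hs : s ≤ c * θ ^ 2) (hq₀ : q₀ ≤ c * θ ^ 2) (hq₁ : q₁ ≤ c * θ ^ 2) (hτ₀ : τ₀ ≤ c * θ)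
    (hτ₁ : τ₁ ≤ c * θ) (hγU : γU ≤ c * θ ^ 2) (hγU₁ : γU₁ ≤ c * θ ^ 2) (hγ₀ : γ₀ ≤ c * θ ^ (2 + β))
    (hγ₁ : γ₁ ≤ c * θ ^ (2 + β)) (hγγU : γγU ≤ c * θ ^ (2 + β)) (hγγP : γγP ≤ c * θ ^ (2 + β))
    (hγγ₁ : γγ₁ ≤ c * θ ^ (2 + β)) :
    secondDev C s q₀ τ₀ (gradPoly C s q₀ q₁ τ₀ τ₁ γU γ₀ γ₁) γU γ₀ (devGradPoly C s q₁ τ₀ τ₁ γ₀ γ₁) γγU γγP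
        (devHessPoly C s q₁ τ₀ τ₁ (gradPoly C s q₀ q₁ τ₀ τ₁ γU γ₀ γ₁) γU γU₁ γ₁ γγP γγ₁) ≤
      73 * (118 * c ^ 5) ^ 5 * θ ^ (2 + β) := by
  have hc0 : 0 ≤ c := by linarith
  have hθ0 := hθ.le
  have hr0 : 0 ≤ θ ^ (2 + β) := Real.rpow_nonneg hθ0 _
  have hc5 : c ≤ c ^ 5 := le_self_pow₀ hc1 (by norm_num)
  have hc45 : c ^ 4 ≤ c ^ 5 := pow_le_pow_right₀ hc1 (by norm_num)
  have hc50 : 0 ≤ c ^ 5 := by positivity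
  have hcc : c ≤ 118 * c ^ 5 := by linarith
  have hc1' : 1 ≤ 118 * c ^ 5 := hc1.trans hcc
  have lift2 : ∀ {x : ℝ}, x ≤ c * θ ^ 2 → x ≤ 118 * c ^ 5 * θ ^ 2 := fun hx =>
    hx.trans (mul_le_mul_of_nonneg_right hcc (by positivity))
  have liftr : ∀ {x : ℝ}, x ≤ c * θ ^ (2 + β) → x ≤ 118 * c ^ 5 * θ ^ (2 + β) := fun hx =>
    hx.trans (mul_le_mul_of_nonneg_right hcc hr0)
  have hτ₀' : τ₀ ≤ 118 * c ^ 5 * θ := hτ₀.trans (mul_le_mul_of_nonneg_right hcc hθ0)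
  have hG := gradPoly_le_rateA hθ hθ1 hβ0 hc1 hC0 hs0 hq0 hq1 hτ0 hτ1 hγU0 hγ00 hγ10 hC hs hq₀ hq₁ hτ₀ hτ₁ hγU
    hγ₀ hγ₁
  have hG' : gradPoly C s q₀ q₁ τ₀ τ₁ γU γ₀ γ₁ ≤ 118 * c ^ 5 * θ ^ 2 :=
    hG.trans (mul_le_mul_of_nonneg_right (by linarith) (by positivity))
  have hG0 := gradPoly_nonneg hC0 hs0 hq0 hq1 hτ0 hτ1 hγU0 hγ00 hγ10
  have hE := devGradPoly_le_rateA hθ hθ1 hβ1 hc1 hC0 hs0 hτ0 hτ1 hC hs hq₁ hτ₀ hτ₁ hγ₀ hγ₁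
  have hE' : devGradPoly C s q₁ τ₀ τ₁ γ₀ γ₁ ≤ 118 * c ^ 5 * θ ^ (2 + β) :=
    hE.trans (mul_le_mul_of_nonneg_right (by linarith) hr0)
  have hE0 : 0 ≤ devGradPoly C s q₁ τ₀ τ₁ γ₀ γ₁ := by unfold devGradPoly; positivity
  have hEE := devHessPoly_le_rateA hθ hθ1 hβ1 hc1 hC0 hs0 hτ0 hτ1 hG0 hγU0 hγU10 hγ10 hC hs hq₁ hτ₀ hτ₁ hG hγU
    hγU₁ hγ₁ hγγP hγγ₁
  have hEE0 := devHessPoly_nonneg hC0 hs0 hq1 hτ0 hτ1 hG0 hγU0 hγU10 hγ10 hγγP0 hγγ10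
  exact secondDev_le_rateA hθ hθ1 hβ0 hβ1 hc1' hC0 hs0 hq0 hτ0 hG0 hγU0 hγ00 hE0 hγγU0 hγγP0 hEE0 (hC.trans hcc)
    (lift2 hs) (lift2 hq₀) hτ₀' hG' (lift2 hγU) (liftr hγ₀) hE' (liftr hγγU) (liftr hγγP) hEE

/-- **THE TELESCOPED ALL-RAW WINDOW INSIDE A `θ`-INDEPENDENT MULTIPLE OF THE PRINTED WINDOW UNDER THE PRINTED-TYPE
DICTIONARY WITH A CONSTANT COMB COUNT** (arith, reading (A) — the corrected bottom line of the located audit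
`t4/T4-EST-OG1p-D3.md` v1.1): under the hypotheses of `secondDev_allRaw_le_rateA` the window triple of
`windowData_comb_second_allRaw_tel`, `b = (C·s, G_raw + C·s·γU, L^{1−β}·σ)`, satisfies
`N_{κ(θ)}(b) ≤ 22c⁴ + L^{1−β}·73·(118c⁵)⁵` for the printed weights `κ(θ) = (θ, θ², θ^{2+β})` — UNIFORMLY IN `θ`,
with a constant depending on `c` and the block side `L` only (`L^{1−β} ≤ L`, `rpow_one_sub_le_self`), and with NO
second- or third-order sup letter beyond the Hölder-derived rate `θ^{2+β}`.  HONEST: if instead the block side is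
`L^j = θ^{−1}` (reading (B): only `Cθ ≤ c`), this constant is `θ^{−(1−β)}`-large AND the gradient slot fails
(`gradSlot_not_uniform_readingB`).  [folklore] -/
theorem winN_printWin_second_allRaw_tel_le {L : ℕ} (hθ : 0 < θ) (hθ1 : θ ≤ 1) (hβ0 : 0 ≤ β) (hβ1 : β ≤ 1)
    (hc1 : 1 ≤ c) (hC0 : 0 ≤ C) (hs0 : 0 ≤ s) (hq0 : 0 ≤ q₀) (hq1 : 0 ≤ q₁) (hτ0 : 0 ≤ τ₀) (hτ1 : 0 ≤ τ₁)
    (hγU0 : 0 ≤ γU) (hγU10 : 0 ≤ γU₁) (hγ00 : 0 ≤ γ₀) (hγ10 : 0 ≤ γ₁) (hγγU0 : 0 ≤ γγU) (hγγP0 : 0 ≤ γγP)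
    (hγγ10 : 0 ≤ γγ₁) (hC : C ≤ c) (hs : s ≤ c * θ ^ 2) (hq₀ : q₀ ≤ c * θ ^ 2) (hq₁ : q₁ ≤ c * θ ^ 2)
    (hτ₀ : τ₀ ≤ c * θ) (hτ₁ : τ₁ ≤ c * θ) (hγU : γU ≤ c * θ ^ 2) (hγU₁ : γU₁ ≤ c * θ ^ 2)
    (hγ₀ : γ₀ ≤ c * θ ^ (2 + β)) (hγ₁ : γ₁ ≤ c * θ ^ (2 + β)) (hγγU : γγU ≤ c * θ ^ (2 + β))
    (hγγP : γγP ≤ c * θ ^ (2 + β)) (hγγ₁ : γγ₁ ≤ c * θ ^ (2 + β)) :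
    winN (printWin θ β) ⟨C * s, gradPoly C s q₀ q₁ τ₀ τ₁ γU γ₀ γ₁ + C * s * γU,
        (L : ℝ) ^ (1 - β) *
          secondDev C s q₀ τ₀ (gradPoly C s q₀ q₁ τ₀ τ₁ γU γ₀ γ₁) γU γ₀ (devGradPoly C s q₁ τ₀ τ₁ γ₀ γ₁)
            γγU γγP (devHessPoly C s q₁ τ₀ τ₁ (gradPoly C s q₀ q₁ τ₀ τ₁ γU γ₀ γ₁) γU γU₁ γ₁ γγP γγ₁)⟩ ≤
      22 * c ^ 4 + (L : ℝ) ^ (1 - β) * (73 * (118 * c ^ 5) ^ 5) := by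
  have hc0 : 0 ≤ c := by linarith
  have hθ0 := hθ.le
  have hr0 : 0 ≤ θ ^ (2 + β) := Real.rpow_nonneg hθ0 _
  have hL0 : (0 : ℝ) ≤ (L : ℝ) ^ (1 - β) := Real.rpow_nonneg (Nat.cast_nonneg L) _
  have hK0 : (0 : ℝ) ≤ (L : ℝ) ^ (1 - β) * (73 * (118 * c ^ 5) ^ 5) := by positivity
  have hc24 : c ^ 2 ≤ c ^ 4 := pow_le_pow_right₀ hc1 (by norm_num)
  have hc34 : c ^ 3 ≤ c ^ 4 := pow_le_pow_right₀ hc1 (by norm_num)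
  have hc40 : 0 ≤ c ^ 4 := by positivity
  have hG := gradPoly_le_rateA hθ hθ1 hβ0 hc1 hC0 hs0 hq0 hq1 hτ0 hτ1 hγU0 hγ00 hγ10 hC hs hq₀ hq₁ hτ₀ hτ₁ hγU
    hγ₀ hγ₁
  have hσ := secondDev_allRaw_le_rateA hθ hθ1 hβ0 hβ1 hc1 hC0 hs0 hq0 hq1 hτ0 hτ1 hγU0 hγU10 hγ00 hγ10 hγγU0
    hγγP0 hγγ10 hC hs hq₀ hq₁ hτ₀ hτ₁ hγU hγU₁ hγ₀ hγ₁ hγγU hγγP hγγ₁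
  have h1 : C * s ≤ (22 * c ^ 4 + (L : ℝ) ^ (1 - β) * (73 * (118 * c ^ 5) ^ 5)) * θ := by
    have h : C * s ≤ c * (c * θ ^ 2) := mul_le_mul hC hs hs0 hc0
    have h' : c * (c * θ ^ 2) ≤ c ^ 2 * θ := by
      have : θ ^ 2 ≤ θ := by nlinarith
      nlinarith
    have h'' : c ^ 2 * θ ≤ (22 * c ^ 4 + (L : ℝ) ^ (1 - β) * (73 * (118 * c ^ 5) ^ 5)) * θ :=
      mul_le_mul_of_nonneg_right (by linarith) hθ0
    linarith
  have h2 : gradPoly C s q₀ q₁ τ₀ τ₁ γU γ₀ γ₁ + C * s * γU ≤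
      (22 * c ^ 4 + (L : ℝ) ^ (1 - β) * (73 * (118 * c ^ 5) ^ 5)) * θ ^ 2 := by
    have h : C * s * γU ≤ c * (c * θ ^ 2) * (c * θ ^ 2) :=
      mul_le_mul (mul_le_mul hC hs hs0 hc0) hγU hγU0 (by positivity)
    have h' : c * (c * θ ^ 2) * (c * θ ^ 2) ≤ c ^ 4 * θ ^ 2 := by
      have hθ4 : θ ^ 2 * θ ^ 2 ≤ θ ^ 2 := by nlinarith [pow_le_one₀ hθ0 hθ1 (n := 2)]
      nlinarith
    have h'' : 22 * c ^ 4 * θ ^ 2 ≤ (22 * c ^ 4 + (L : ℝ) ^ (1 - β) * (73 * (118 * c ^ 5) ^ 5)) * θ ^ 2 :=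
      mul_le_mul_of_nonneg_right (by linarith) (by positivity)
    linarith
  have h3 : (L : ℝ) ^ (1 - β) *
      secondDev C s q₀ τ₀ (gradPoly C s q₀ q₁ τ₀ τ₁ γU γ₀ γ₁) γU γ₀ (devGradPoly C s q₁ τ₀ τ₁ γ₀ γ₁)
        γγU γγP (devHessPoly C s q₁ τ₀ τ₁ (gradPoly C s q₀ q₁ τ₀ τ₁ γU γ₀ γ₁) γU γU₁ γ₁ γγP γγ₁) ≤
      (22 * c ^ 4 + (L : ℝ) ^ (1 - β) * (73 * (118 * c ^ 5) ^ 5)) * θ ^ (2 + β) := by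
    have h : (L : ℝ) ^ (1 - β) * secondDev C s q₀ τ₀ (gradPoly C s q₀ q₁ τ₀ τ₁ γU γ₀ γ₁) γU γ₀
        (devGradPoly C s q₁ τ₀ τ₁ γ₀ γ₁) γγU γγP
        (devHessPoly C s q₁ τ₀ τ₁ (gradPoly C s q₀ q₁ τ₀ τ₁ γU γ₀ γ₁) γU γU₁ γ₁ γγP γγ₁) ≤
        (L : ℝ) ^ (1 - β) * (73 * (118 * c ^ 5) ^ 5 * θ ^ (2 + β)) := mul_le_mul_of_nonneg_left hσ hL0
    have h' : (L : ℝ) ^ (1 - β) * (73 * (118 * c ^ 5) ^ 5 * θ ^ (2 + β)) ≤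
        (22 * c ^ 4 + (L : ℝ) ^ (1 - β) * (73 * (118 * c ^ 5) ^ 5)) * θ ^ (2 + β) := by
      have : (22 * c ^ 4 + (L : ℝ) ^ (1 - β) * (73 * (118 * c ^ 5) ^ 5)) * θ ^ (2 + β) =
          22 * c ^ 4 * θ ^ (2 + β) + (L : ℝ) ^ (1 - β) * (73 * (118 * c ^ 5) ^ 5 * θ ^ (2 + β)) := by ring
      rw [this]
      linarith [mul_nonneg (mul_nonneg (by norm_num : (0 : ℝ) ≤ 22) hc40) hr0]
    linarith
  exact (winN_printWin_le_iff hθ).2 ⟨h1, h2, h3⟩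

end RateA

/-! ### [arith] reading (B): the comb count in front of the plaquette letters -/

section ReadingB

variable {θ c β C s q₀ q₁ τ₀ τ₁ γU γ₀ γ₁ : ℝ}

/-- [folklore] (arith) THE COMB COUNT MULTIPLIES THE PLAQUETTE GRADIENTS IN `G_raw`: `C·γ₀ + C·γ₁ ≤ gradPoly C …`
(nonnegative data) — the gradient entry is never below `C` times the raw plaquette-gradient letters. -/
theorem le_gradPoly_C (hC0 : 0 ≤ C) (hs0 : 0 ≤ s) (hq0 : 0 ≤ q₀) (hq1 : 0 ≤ q₁) (hτ0 : 0 ≤ τ₀)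
    (hτ1 : 0 ≤ τ₁) (hγU0 : 0 ≤ γU) (hγ00 : 0 ≤ γ₀) :
    C * γ₀ + C * γ₁ ≤ gradPoly C s q₀ q₁ τ₀ τ₁ γU γ₀ γ₁ := by
  have hA : 0 ≤ s * (1 + C * (2 * q₀ + s + 2 * τ₀)) := by positivity
  have hB : 0 ≤ C * (2 * γU * (C * s + s)) := by positivity
  have hD : 0 ≤ C * (2 * q₁ * (τ₀ + C * s + τ₁)) := by positivity
  have hE : 0 ≤ C * (γ₀ * (2 * (C * s) + s)) := by positivity
  unfold gradPoly
  linarith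

/-- [folklore] (arith) READING (B) SIZES: a saturated count `Cθ = c` and a plaquette gradient at the printed-type rate
`γ₀ = cθ^{2+β}` give the term `C·γ₀ = c²θ^{1+β}` of the gradient entry. -/
theorem readingB_gradTerm (hθ : 0 < θ) (hCθ : C * θ = c) (hγ₀ : γ₀ = c * θ ^ (2 + β)) :
    C * γ₀ = c ^ 2 * θ ^ (1 + β) := by
  have hsplit : θ ^ (2 + β) = θ * θ ^ (1 + β) := by
    rw [show (2 : ℝ) + β = 1 + (1 + β) by ring, Real.rpow_add hθ, Real.rpow_one]
  rw [hγ₀, hsplit, ← hCθ]; ring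

/-- [folklore] (arith) NO POWER OF `θ` IS DOMINATED BY A HIGHER ONE ON `(0, 1]`: for `p < q` there is no
`θ`-independent `a` with `θ^p ≤ a·θ^q` for all `0 < θ ≤ 1` (witness `θ = (2a)^{−1/(q−p)}`).  The general form of
`not_uniform_holderInputs` (`p = 2 + β²`, `q = 2 + β`). -/
theorem rpow_not_dominated {p q : ℝ} (hpq : p < q) :
    ¬ ∃ a : ℝ, ∀ θ : ℝ, 0 < θ → θ ≤ 1 → θ ^ p ≤ a * θ ^ q := by
  rintro ⟨a, ha⟩
  have ha1 : 1 ≤ a := by simpa using ha 1 one_pos le_rfl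
  have ha0 : 0 < 2 * a := by linarith
  have he : 0 < q - p := by linarith
  obtain ⟨T, hT⟩ : ∃ T : ℝ, T = (2 * a) ^ (-(1 / (q - p))) := ⟨_, rfl⟩
  have hT0 : 0 < T := by rw [hT]; exact Real.rpow_pos_of_pos ha0 _
  have hT1 : T ≤ 1 := by
    rw [hT]
    exact Real.rpow_le_one_of_one_le_of_nonpos (by linarith) (neg_nonpos.mpr (div_nonneg zero_le_one he.le))
  have h1 : T ^ (p - q) = 2 * a := by
    rw [hT, ← Real.rpow_mul ha0.le]
    have : -(1 / (q - p)) * (p - q) = (q - p) / (q - p) := by ring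
    rw [this, div_self he.ne', Real.rpow_one]
  have hsplit : T ^ p = T ^ q * (2 * a) := by
    rw [← h1, ← Real.rpow_add hT0]
    congr 1; ring
  have key := ha T hT0 hT1
  rw [hsplit] at key
  have hp : 0 < T ^ q := Real.rpow_pos_of_pos hT0 _
  nlinarith [mul_pos hp (show (0 : ℝ) < a by linarith)]

/-- **THE GRADIENT SLOT IS NOT `θ`-UNIFORM UNDER READING (B) WITH PRINTED-TYPE INPUTS** (arith): for `β < 1` there is
no `θ`-independent `a` with `θ^{1+β} ≤ a·θ²` on `(0, 1]` — so the term `C·γ₀ = c²θ^{1+β}` (`readingB_gradTerm`,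
`le_gradPoly_C`) of the gradient entry is NOT within a `θ`-independent multiple of the gradient weight `θ²` of
`printWin`: with the block side `L^j` (count `C = (d−1)(L^j−1) ≍ θ^{−1}`) and plaquette gradients at the
Hölder-derived rate, the window fails ALREADY AT THE GRADIENT SLOT (by `θ^{−(1−β)}`), before any Hölder-slot
question.  [folklore] -/
theorem gradSlot_not_uniform_readingB {β : ℝ} (hβ1 : β < 1) :
    ¬ ∃ a : ℝ, ∀ θ : ℝ, 0 < θ → θ ≤ 1 → θ ^ (1 + β) ≤ a * θ ^ 2 := by
  rintro ⟨a, ha⟩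
  exact rpow_not_dominated (show 1 + β < (2 : ℝ) by linarith)
    ⟨a, fun θ h0 h1 => by rw [Real.rpow_two]; exact ha θ h0 h1⟩

end ReadingB

end Literature.MathematicalPhysics.QuantumFieldTheory.Balaban1983to89.T4CombSecondRaw
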